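import Literature.NumberTheory.LFunctions.LargeValuesS2AFE
import Literature.NumberTheory.LFunctions.DoubleZetaSumsHeathBrown
import Literature.NumberTheory.LFunctions.LargeValuesAssembly
import HarnessLib

/-!
# Guth–Maynard Proposition 6.1 (the `S₂` bound) and the reduction of `zeroDensity_guth_maynard` to Propositions 10.1 and 11.1

Topic `NumberTheory/LFunctions`, family RH. `LargeValuesAssembly.lean` reduces the tree's named fact
`Literature.NumberTheory.LFunctions.zeroDensity_guth_maynard` (L. Guth, J. Maynard, *New large value
estimates for Dirichlet polynomials*, Ann. of Math. 203 (2026), Theorem 1.2) to Propositions 6.1, 10.1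
and 11.1 of the paper (`GuthMaynardAssembly.zeroDensity_guth_maynard_of_bounds`, hypotheses `hS2`,
`hS3`, `hE`). This file PROVES Proposition 6.1 in the required form — the hypothesis `hS2` — and so
reduces the named fact to Propositions 10.1 and 11.1 alone
(`GuthMaynardS2.zeroDensity_guth_maynard_of_S3_of_energy`). It continues `LargeValuesS2AFE.lean`
(Lemma 6.2, the approximate functional equation for `B_N(τ) = ∑_{m≠0} ĥ_τ(mN)`, and the mean square
of `B_N` over dyadic classes of differences, display (6.2) of the paper) and uses the tree's
Heath-Brown theorem `HeathBrownDZS.heathBrown_differenceSet` (`DoubleZetaSumsHeathBrown.lean`,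
Guth–Maynard's Theorem 1.6) and divisor bound `Literature.NumberTheory.Sieve.exists_card_divisors_le_mul_rpow'`.

* §6 `dps_le_fourth_root` — **(6.3) with `k = 4`**: Cauchy–Schwarz over the pairs twice (in place of
  Hölder) and the product device `DoubleZetaSums.dps_mul_le` twice:
  `dps W F a ≤ |W|^{3/2} D₂ D₄^{1/2} (dps W G₄ 1)^{1/4}` for `F·F ⊆ G₂`, `G₂·G₂ ⊆ G₄`, divisor bounds
  `D₂, D₄` on `G₂, G₄` (the coefficients of the fourth power are bounded by the divisor function);
  `dps_le_card_mul_sum_filter`, `dps_union_le` (splitting ranges).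
* §7 `sum_sq_norm_dirD_le` — **(6.3)–(6.5)**: for `ε > 0` there are `C, T₀` with
  `∑_{t,t'∈W} |D_M(t−t'+2πξ)|² ≤ C T^ε (M|W|² + M²|W|^{7/4} + M T^{1/8}|W|^{29/16})` for `T ≥ T₀`,
  `1 ≤ M ≤ T`, `W` finite `1`-separated in an interval of length `T`, `ξ ∈ ℝ` (dyadic blocks
  `(2^b, 2^{b+1}]` in `m`, §6, and Heath-Brown's theorem on the four ranges `(L, 2L]` covering
  `(16^b, 16^{b+1}]`).
* §8 `S2_eq_three_mul` (cyclic symmetry of `S₂`), `norm_S2_le`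
  (`|S₂| ≤ C N³(∑_{t,t'}|B_N(t−t')|² + |W|³(1+L)⁴δ^{-j})`, the terms with `t₁ ≠ t₃` being negligible by
  Lemma 4.3), `sum_pairs_le_classes` (diagonal / `|t−t'| ≤ Θ` / dyadic classes `2^i ≤ |t−t'| ≤ 2^{i+1}`).
* §9 `class_le`, **`S2_bound` = Proposition 6.1 with `k = 4` in the setting of Proposition 3.1**
  (`T = N^{6/5}`, `W` `T^ε`-separated in an interval of length `T`):
  `|S₂| ≤ C N^δ (N²|W|² + TN|W|^{7/4} + N²T^{1/8}|W|^{29/16})` for `N ≥ N₀(w, ε, δ)`, i.e. exactly `hS2`;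
  and `zeroDensity_guth_maynard_of_S3_of_energy : (hS3) → (hE) → zeroDensity_guth_maynard`.

Remarks on the proof of `S2_bound`. Differences `|t−t'| ≤ Θ = N^{1−η}` are treated directly by
Lemma 4.3 (`|B_N(τ)| ≪_j (1+|τ|)^j N^{-j}`, there is no stationary point), the classes
`2^i = T₀ > Θ/2` by `GuthMaynardS2.sum_sq_norm_coefB_le` with `M = ⌈N^ηT₀/N⌉ ≍ N^ηT₀/N` (so that
`M/T₀ ≪ N^{η−1}`, `M²/T₀ ≪ N^{2η−2}T`) and §7; the number of classes, `K` and the divisor bounds cost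
`N^{O(η)}`, and `η = min(δ,1)/10`, `j = 12 + ⌈4/η⌉ + ⌈6/ε⌉` make all losses `≤ N^δ` and all error terms
`≤ N²|W|²`. No definition and no named fact is introduced; everything in this file is proved.

## References

* L. Guth, J. Maynard, *New large value estimates for Dirichlet polynomials*, Ann. of Math. (2)
  203 (2026), no. 2; arXiv:2405.20552 (2024): §6 (Proposition 6.1, (6.2)–(6.5), Theorem 1.6),
  §12, Theorem 1.2. [key `GuthMaynard2026`]
* D. R. Heath-Brown, *A large values estimate for Dirichlet polynomials*, J. London Math. Soc. (2)
  20 (1979), 8–18, Theorem 1 (via `DoubleZetaSumsHeathBrown.lean`).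
* G. H. Hardy, E. M. Wright, *An Introduction to the Theory of Numbers*, Thm. 315 (the divisor bound,
  via `Literature/NumberTheory/Sieve/DivisorBound.lean`).
-/

noncomputable section

open Real Set Filter Topology Complex MeasureTheory Finset
open scoped FourierTransform ContDiff ComplexConjugate

namespace Literature.NumberTheory.LFunctions

namespace GuthMaynardS2

open GuthMaynardFourier GuthMaynardEnergy GuthMaynardRFunction Literature.Analysis.Fourier DoubleZetaSums

/-! ## §6. Double zeta sums: Cauchy–Schwarz twice and Heath-Brown's theorem (the step (6.3)–(6.5)) -/

/-- `‖∑_{s∈S} z_s‖² ≤ |S| ∑_{s∈S} ‖z_s‖²`. [folklore] -/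
theorem norm_sum_sq_le_card_mul {ι : Type*} (S : Finset ι) (z : ι → ℂ) :
    ‖∑ s ∈ S, z s‖ ^ 2 ≤ S.card * ∑ s ∈ S, ‖z s‖ ^ 2 := by
  have h1 : ‖∑ s ∈ S, z s‖ ≤ ∑ s ∈ S, ‖z s‖ := norm_sum_le _ _
  have h2 : (∑ s ∈ S, ‖z s‖) ^ 2 ≤ S.card * ∑ s ∈ S, ‖z s‖ ^ 2 := by
    have h := Finset.sum_mul_sq_le_sq_mul_sq S (fun _ ↦ (1 : ℝ)) (fun s ↦ ‖z s‖)
    simp only [one_mul, one_pow, Finset.sum_const, nsmul_eq_mul, mul_one] at h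
    exact h
  exact (pow_le_pow_left₀ (norm_nonneg _) h1 2).trans h2

/-- **Cauchy–Schwarz over the pairs**: `(∑_{t,t'} x(t,t'))² ≤ |W|² ∑_{t,t'} x(t,t')²`. [folklore] -/
theorem sq_sum_sum_le_card_sq_mul (W : Finset ℝ) (x : ℝ → ℝ → ℝ) :
    (∑ t ∈ W, ∑ t' ∈ W, x t t') ^ 2 ≤ (W.card : ℝ) ^ 2 * ∑ t ∈ W, ∑ t' ∈ W, x t t' ^ 2 := by
  rw [← Finset.sum_product', ← Finset.sum_product']
  have h := Finset.sum_mul_sq_le_sq_mul_sq (W ×ˢ W) (fun _ ↦ (1 : ℝ)) (fun p ↦ x p.1 p.2)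
  simp only [one_mul, one_pow, Finset.sum_const, nsmul_eq_mul, mul_one, Finset.card_product] at h
  push_cast at h
  rw [sq (W.card : ℝ)]
  exact h

/-- Splitting the range of a double zeta sum in two: `dps W (G₁ ∪ G₂) a ≤ 2(dps W G₁ a + dps W G₂ a)` for
disjoint `G₁, G₂`. [folklore] -/
theorem dps_union_le (W : Finset ℝ) {G₁ G₂ : Finset ℕ} (h : Disjoint G₁ G₂) (a : ℕ → ℂ) :
    dps W (G₁ ∪ G₂) a ≤ 2 * (dps W G₁ a + dps W G₂ a) := by
  unfold dps
  rw [mul_add, Finset.mul_sum, Finset.mul_sum, ← Finset.sum_add_distrib]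
  refine Finset.sum_le_sum fun t _ ↦ ?_
  rw [Finset.mul_sum, Finset.mul_sum, ← Finset.sum_add_distrib]
  refine Finset.sum_le_sum fun t' _ ↦ ?_
  rw [Finset.sum_union h]
  set x := ∑ n ∈ G₁, a n * twist n (t - t')
  set y := ∑ n ∈ G₂, a n * twist n (t - t')
  have h1 : ‖x + y‖ ^ 2 ≤ (‖x‖ + ‖y‖) ^ 2 := pow_le_pow_left₀ (norm_nonneg _) (norm_add_le x y) 2
  nlinarith [h1, sq_nonneg (‖x‖ - ‖y‖)]

/-- Splitting the range of a double zeta sum into the parts of a partition indexed by `S`: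
`dps W F a ≤ |S| ∑_{s∈S} dps W (F ∩ part s) a`. [folklore] -/
theorem dps_le_card_mul_sum_filter {ι : Type*} (W : Finset ℝ) (F : Finset ℕ) (a : ℕ → ℂ)
    (S : Finset ι) (part : ℕ → ι) (hpart : ∀ n ∈ F, part n ∈ S) [DecidableEq ι] :
    dps W F a ≤ S.card * ∑ s ∈ S, dps W (F.filter fun n ↦ part n = s) a := by
  unfold dps
  rw [Finset.mul_sum]
  have hsplit : ∀ θ : ℝ, ∑ n ∈ F, a n * twist n θ =
      ∑ s ∈ S, ∑ n ∈ F.filter (fun n ↦ part n = s), a n * twist n θ := by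
    intro θ
    rw [← Finset.sum_fiberwise_of_maps_to hpart (fun n ↦ a n * twist n θ)]
  set x : ℝ → ℝ → ι → ℝ := fun t t' s ↦
    ‖∑ n ∈ F.filter (fun n ↦ part n = s), a n * twist n (t - t')‖ ^ 2 with hx
  have hcomm : ∑ t ∈ W, ∑ t' ∈ W, ∑ s ∈ S, x t t' s = ∑ s ∈ S, ∑ t ∈ W, ∑ t' ∈ W, x t t' s := by
    calc ∑ t ∈ W, ∑ t' ∈ W, ∑ s ∈ S, x t t' s = ∑ t ∈ W, ∑ s ∈ S, ∑ t' ∈ W, x t t' s :=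
          Finset.sum_congr rfl fun t _ ↦ Finset.sum_comm
      _ = ∑ s ∈ S, ∑ t ∈ W, ∑ t' ∈ W, x t t' s := Finset.sum_comm
  calc ∑ t ∈ W, ∑ t' ∈ W, ‖∑ n ∈ F, a n * twist n (t - t')‖ ^ 2
      ≤ ∑ t ∈ W, ∑ t' ∈ W, ((S.card : ℝ) * ∑ s ∈ S, x t t' s) := by
        refine Finset.sum_le_sum fun t _ ↦ Finset.sum_le_sum fun t' _ ↦ ?_
        rw [hsplit]
        exact norm_sum_sq_le_card_mul S _
    _ = (S.card : ℝ) * ∑ t ∈ W, ∑ t' ∈ W, ∑ s ∈ S, x t t' s := by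
        rw [Finset.mul_sum]
        refine Finset.sum_congr rfl fun t _ ↦ ?_
        rw [Finset.mul_sum]
    _ = ∑ s ∈ S, (S.card : ℝ) * ∑ t ∈ W, ∑ t' ∈ W, x t t' s := by
        rw [hcomm, Finset.mul_sum]

/-- `‖P(θ)‖⁴ = ‖P(θ)·P(θ)‖²`. [folklore] -/
theorem norm_pow_four_eq (z : ℂ) : ‖z‖ ^ 4 = ‖z * z‖ ^ 2 := by
  rw [norm_mul]; ring

/-- **One Cauchy–Schwarz and one product step**: for `F ⊆ ℕ_{≥1}` with `F·F ⊆ G ⊆ ℕ_{≥1}`,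
`d ≤ D` on `G` and `|a_n| ≤ 1` on `F`,
`(dps W F a)² ≤ |W|² D² dps W G 1` ("we apply Hölder's inequality … and rewrite the `2k`-th power of the
Dirichlet polynomial as the `2`-nd power of a longer Dirichlet polynomial … `b_m ≤ M^{o_k(1)}` by the divisor
bound", the case `k = 2`). [cite: GuthMaynard2026, Section 6, (6.3)] -/
theorem dps_sq_le_card_sq_mul (W : Finset ℝ) {F G : Finset ℕ} (hF : 0 ∉ F) (hG : 0 ∉ G)
    (hFG : ∀ n ∈ F, ∀ m ∈ F, n * m ∈ G) {a : ℕ → ℂ} (ha : ∀ n ∈ F, ‖a n‖ ≤ 1) {D : ℝ}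
    (hD : ∀ k ∈ G, (k.divisors.card : ℝ) ≤ D) :
    dps W F a ^ 2 ≤ (W.card : ℝ) ^ 2 * (D ^ 2 * dps W G (fun _ ↦ (1 : ℂ))) := by
  have hCS := sq_sum_sum_le_card_sq_mul W (fun t t' ↦ ‖∑ n ∈ F, a n * twist n (t - t')‖ ^ 2)
  refine (le_of_eq (by rfl)).trans (hCS.trans ?_)
  refine mul_le_mul_of_nonneg_left ?_ (by positivity)
  have hmul := dps_mul_le W hF hG hFG (a := a) (c := a) (b := fun _ ↦ (1 : ℝ))
    (fun _ _ ↦ zero_le_one) (fun n hn m hm ↦ by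
      rw [norm_mul]
      calc ‖a n‖ * ‖a m‖ ≤ 1 * 1 := mul_le_mul (ha n hn) (ha m hm) (norm_nonneg _) zero_le_one
        _ = 1 := one_mul 1) hD
  simp only [Complex.ofReal_one] at hmul
  refine (le_of_eq ?_).trans hmul
  refine Finset.sum_congr rfl fun t _ ↦ Finset.sum_congr rfl fun t' _ ↦ ?_
  rw [← norm_pow_four_eq]; ring

/-- **Cauchy–Schwarz twice (= Hölder with `k = 4`) and the divisor bound**: if `F·F ⊆ G₂`, `G₂·G₂ ⊆ G₄`
(all in `ℕ_{≥1}`), `d ≤ D₂` on `G₂`, `d ≤ D₄` on `G₄` (`D₂, D₄ ≥ 0`) and `|a_n| ≤ 1` on `F`, then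
`dps W F a ≤ |W|^{3/2} D₂ D₄^{1/2} (dps W G₄ 1)^{1/4}`
(`∑|P|² ≤ |W|^{2−2/k}(∑|P^k|²)^{1/k}` with `k = 4`). [cite: GuthMaynard2026, Section 6, (6.3)] -/
theorem dps_le_fourth_root (W : Finset ℝ) {F G₂ G₄ : Finset ℕ} (hF : 0 ∉ F) (hG₂ : 0 ∉ G₂)
    (hG₄ : 0 ∉ G₄) (hFG : ∀ n ∈ F, ∀ m ∈ F, n * m ∈ G₂) (hGG : ∀ n ∈ G₂, ∀ m ∈ G₂, n * m ∈ G₄)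
    {a : ℕ → ℂ} (ha : ∀ n ∈ F, ‖a n‖ ≤ 1) {D₂ D₄ : ℝ} (hD₂0 : 0 ≤ D₂) (hD₄0 : 0 ≤ D₄)
    (hD₂ : ∀ k ∈ G₂, (k.divisors.card : ℝ) ≤ D₂) (hD₄ : ∀ k ∈ G₄, (k.divisors.card : ℝ) ≤ D₄) :
    dps W F a ≤ (W.card : ℝ) ^ (3 / 2 : ℝ) * D₂ * D₄ ^ (1 / 2 : ℝ) *
      (dps W G₄ (fun _ ↦ (1 : ℂ))) ^ (1 / 4 : ℝ) := by
  set R : ℝ := (W.card : ℝ) with hR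
  have hR0 : 0 ≤ R := Nat.cast_nonneg _
  set Q₂ : ℝ := dps W G₂ (fun _ ↦ (1 : ℂ)) with hQ₂
  set Q₄ : ℝ := dps W G₄ (fun _ ↦ (1 : ℂ)) with hQ₄
  have hQ₂0 : 0 ≤ Q₂ := dps_nonneg _ _ _
  have hQ₄0 : 0 ≤ Q₄ := dps_nonneg _ _ _
  have hP0 : 0 ≤ dps W F a := dps_nonneg _ _ _
  -- first step
  have h1 : dps W F a ^ 2 ≤ R ^ 2 * (D₂ ^ 2 * Q₂) := dps_sq_le_card_sq_mul W hF hG₂ hFG ha hD₂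
  -- second step (coefficients `1`)
  have h2 : Q₂ ^ 2 ≤ R ^ 2 * (D₄ ^ 2 * Q₄) :=
    dps_sq_le_card_sq_mul W hG₂ hG₄ hGG (a := fun _ ↦ (1 : ℂ)) (fun _ _ ↦ by simp) hD₄
  -- take roots
  have h1' : dps W F a ≤ R * D₂ * Real.sqrt Q₂ := by
    have : dps W F a ^ 2 ≤ (R * D₂ * Real.sqrt Q₂) ^ 2 := by
      rw [mul_pow, mul_pow, Real.sq_sqrt hQ₂0]; linarith [h1]
    exact (pow_le_pow_iff_left₀ hP0 (by positivity) two_ne_zero).mp this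
  have h2' : Q₂ ≤ R * D₄ * Real.sqrt Q₄ := by
    have : Q₂ ^ 2 ≤ (R * D₄ * Real.sqrt Q₄) ^ 2 := by
      rw [mul_pow, mul_pow, Real.sq_sqrt hQ₄0]; linarith [h2]
    exact (pow_le_pow_iff_left₀ hQ₂0 (by positivity) two_ne_zero).mp this
  have h3 : Real.sqrt Q₂ ≤ Real.sqrt R * Real.sqrt D₄ * Q₄ ^ (1 / 4 : ℝ) := by
    calc Real.sqrt Q₂ ≤ Real.sqrt (R * D₄ * Real.sqrt Q₄) := Real.sqrt_le_sqrt h2'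
      _ = Real.sqrt R * Real.sqrt D₄ * Q₄ ^ (1 / 4 : ℝ) := by
          rw [Real.sqrt_mul (by positivity), Real.sqrt_mul hR0, Real.sqrt_eq_rpow, Real.sqrt_eq_rpow,
            Real.sqrt_eq_rpow, Real.sqrt_eq_rpow, ← Real.rpow_mul hQ₄0]
          norm_num
  calc dps W F a ≤ R * D₂ * Real.sqrt Q₂ := h1'
    _ ≤ R * D₂ * (Real.sqrt R * Real.sqrt D₄ * Q₄ ^ (1 / 4 : ℝ)) :=
        mul_le_mul_of_nonneg_left h3 (by positivity)
    _ = R ^ (3 / 2 : ℝ) * D₂ * D₄ ^ (1 / 2 : ℝ) * Q₄ ^ (1 / 4 : ℝ) := by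
        rw [Real.sqrt_eq_rpow, Real.sqrt_eq_rpow,
          show R ^ (3 / 2 : ℝ) = R * R ^ (1 / 2 : ℝ) by
            rw [show (3 / 2 : ℝ) = 1 + 1 / 2 by norm_num, Real.rpow_add' hR0 (by norm_num),
              Real.rpow_one]]
        ring

/-! ## §7. The bound for the double zeta sums of `D_M(· + 2πξ)` from Heath-Brown's theorem -/

/-- `B + 1 ≤ C_η M^η` for `B = ⌊log₂ M⌋` (`M ≥ 1`). [folklore] -/
theorem natLog_add_one_le {η : ℝ} (hη : 0 < η) {M : ℕ} (hM : 1 ≤ M) :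
    ((Nat.log 2 M : ℕ) : ℝ) + 1 ≤ (1 / (η * Real.log 2) + 1) * (M : ℝ) ^ η := by
  have hM0 : (0 : ℝ) < M := by exact_mod_cast hM
  have hlog2 : 0 < Real.log 2 := Real.log_pos one_lt_two
  have h1 : (2 : ℝ) ^ (Nat.log 2 M) ≤ M := by exact_mod_cast Nat.pow_log_le_self 2 (by omega : M ≠ 0)
  have h2 : (Nat.log 2 M : ℝ) * Real.log 2 ≤ Real.log M := by
    rw [← Real.log_pow]; exact Real.log_le_log (by positivity) h1
  have h3 : Real.log M ≤ (M : ℝ) ^ η / η := Real.log_le_rpow_div hM0.le hη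
  have h4 : (Nat.log 2 M : ℝ) ≤ (M : ℝ) ^ η / (η * Real.log 2) := by
    rw [le_div_iff₀ (by positivity)]
    calc (Nat.log 2 M : ℝ) * (η * Real.log 2) = η * ((Nat.log 2 M : ℝ) * Real.log 2) := by ring
      _ ≤ η * Real.log M := mul_le_mul_of_nonneg_left h2 hη.le
      _ ≤ η * ((M : ℝ) ^ η / η) := mul_le_mul_of_nonneg_left h3 hη.le
      _ = (M : ℝ) ^ η := by field_simp
  have h5 : (1 : ℝ) ≤ (M : ℝ) ^ η := Real.one_le_rpow (by exact_mod_cast hM) hη.le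
  calc ((Nat.log 2 M : ℕ) : ℝ) + 1 ≤ (M : ℝ) ^ η / (η * Real.log 2) + (M : ℝ) ^ η := add_le_add h4 h5
    _ = (1 / (η * Real.log 2) + 1) * (M : ℝ) ^ η := by ring

/-- Membership in the dyadic block `F_b = {m ∈ (1, M] : ⌊log₂ (m−1)⌋ = b}`: `2 ≤ m ≤ M` and
`2^b < m ≤ 2^{b+1}`. [folklore] -/
theorem mem_block {M b m : ℕ} (hm : m ∈ (Finset.Ioc 1 M).filter (fun m ↦ Nat.log 2 (m - 1) = b)) :
    2 ≤ m ∧ m ≤ M ∧ 2 ^ b + 1 ≤ m ∧ m ≤ 2 ^ (b + 1) := by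
  rw [Finset.mem_filter, Finset.mem_Ioc] at hm
  obtain ⟨⟨h1, h2⟩, h3⟩ := hm
  have h4 : 2 ^ b ≤ m - 1 := by rw [← h3]; exact Nat.pow_log_le_self 2 (by omega)
  have h5 : m - 1 < 2 ^ (b + 1) := by rw [← h3]; exact Nat.lt_pow_succ_log_self one_lt_two (m - 1)
  omega

/-- For `x ≥ 0`, `(x ^ n) ^ r = x ^ (n r)`. [folklore] -/
theorem pow_rpow_eq {x : ℝ} (hx : 0 ≤ x) (n : ℕ) (r : ℝ) : (x ^ n) ^ r = x ^ ((n : ℝ) * r) := by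
  rw [← Real.rpow_natCast, ← Real.rpow_mul hx]

/-- `4^b = 2^b·2^b`, `16^b = 4^b·4^b`. [folklore] -/
theorem four_pow_eq (b : ℕ) : 4 ^ b = 2 ^ b * 2 ^ b := by
  rw [← mul_pow]; norm_num

/-- `16^b = 4^b·4^b`. [folklore] -/
theorem sixteen_pow_eq (b : ℕ) : 16 ^ b = 4 ^ b * 4 ^ b := by
  rw [← mul_pow]; norm_num

/-- `(16 : ℝ)^b = ((2:ℝ)^b)^4`. [folklore] -/
theorem sixteen_pow_eq_real (b : ℕ) : (16 : ℝ) ^ b = ((2 : ℝ) ^ b) ^ 4 := by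
  rw [← pow_mul, mul_comm, pow_mul]; norm_num

set_option maxHeartbeats 1000000 in
/-- **Heath-Brown's theorem on the range `(16^b, 16^{b+1}]`** (four dyadic pieces `(L, 2L]`,
`L = 16^b, 2·16^b, 4·16^b, 8·16^b`): with `2^b ≤ M` and the tree's
`HeathBrownDZS.heathBrown_differenceSet` in the form `hHB` (for the given `T`),
`dps W (16^b,16^{b+1}] 1 ≤ 128 C_h T^{ε'} (|W|²M⁴ + 8|W|M⁸ + |W|^{5/4}T^{1/2}M⁴)`.
[cite: GuthMaynard2026, Section 6, (6.4)] -/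
theorem dps_sixteen_range_le {Ch ε' : ℝ} (hCh0 : 0 ≤ Ch) {T : ℝ} (hT0 : 0 ≤ T) (W : Finset ℝ)
    (hCh : ∀ (L : ℕ), 1 ≤ L →
      dps W (Finset.Ioc L (2 * L)) (fun _ ↦ (1 : ℂ)) ≤
        Ch * T ^ ε' * ((W.card : ℝ) ^ 2 * L + (W.card : ℝ) * (L : ℝ) ^ 2 +
          (W.card : ℝ) ^ (5 / 4 : ℝ) * T ^ (1 / 2 : ℝ) * L))
    {M b : ℕ} (h2b : (2 : ℝ) ^ b ≤ M) :
    dps W (Finset.Ioc (16 ^ b) (16 ^ (b + 1))) (fun _ ↦ (1 : ℂ)) ≤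
      128 * Ch * T ^ ε' * ((W.card : ℝ) ^ 2 * (M : ℝ) ^ 4 + 8 * ((W.card : ℝ) * (M : ℝ) ^ 8) +
        (W.card : ℝ) ^ (5 / 4 : ℝ) * T ^ (1 / 2 : ℝ) * (M : ℝ) ^ 4) := by
  set R : ℝ := (W.card : ℝ) with hR
  set L0 : ℕ := 16 ^ b with hL0def
  have hL0pos : 1 ≤ L0 := Nat.one_le_pow _ _ (by norm_num)
  have hL0M : (L0 : ℝ) ≤ (M : ℝ) ^ 4 := by
    rw [hL0def]; push_cast; rw [sixteen_pow_eq_real]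
    exact pow_le_pow_left₀ (by positivity) h2b 4
  have hHBj : ∀ c : ℕ, 1 ≤ c → c ≤ 8 →
      dps W (Finset.Ioc (c * L0) (2 * (c * L0))) (fun _ ↦ (1 : ℂ)) ≤
        Ch * T ^ ε' * (R ^ 2 * (8 * (M : ℝ) ^ 4) + R * (8 * (M : ℝ) ^ 4) ^ 2 +
          R ^ (5 / 4 : ℝ) * T ^ (1 / 2 : ℝ) * (8 * (M : ℝ) ^ 4)) := by
    intro c hc hc8
    set L : ℕ := c * L0 with hLdef
    have hL1 : 1 ≤ L := Nat.one_le_iff_ne_zero.mpr (by rw [hLdef]; positivity)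
    have hL8 : (L : ℝ) ≤ 8 * (M : ℝ) ^ 4 := by
      rw [hLdef]; push_cast
      have hc8' : (c : ℝ) ≤ 8 := by exact_mod_cast hc8
      exact mul_le_mul hc8' hL0M (by positivity) (by norm_num)
    refine (hCh L hL1).trans ?_
    have hL0 : (0 : ℝ) ≤ L := Nat.cast_nonneg L
    have hC0 : 0 ≤ Ch * T ^ ε' := by positivity
    gcongr
  -- `(16^b, 16^{b+1}]` is the union of the four ranges `(cL0, 2cL0]`, `c = 1, 2, 4, 8`
  have hdisj : ∀ a₁ b₁ a₂ b₂ : ℕ, b₁ ≤ a₂ → Disjoint (Finset.Ioc a₁ b₁) (Finset.Ioc a₂ b₂) := by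
    intro a₁ b₁ a₂ b₂ h
    exact Finset.disjoint_left.mpr fun x h1 h2 ↦ by
      rw [Finset.mem_Ioc] at h1 h2; omega
  have e01 : 2 * (1 * L0) = 2 * L0 := by ring
  have e12 : 2 * (2 * L0) = 4 * L0 := by ring
  have e24 : 2 * (4 * L0) = 8 * L0 := by ring
  have e48 : 2 * (8 * L0) = 16 ^ (b + 1) := by rw [hL0def, pow_succ]; ring
  have e0 : 1 * L0 = 16 ^ b := by rw [hL0def, one_mul]
  have f0 := hHBj 1 le_rfl (by norm_num)
  have f1 := hHBj 2 (by norm_num) (by norm_num)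
  have f2 := hHBj 4 (by norm_num) (by norm_num)
  have f3 := hHBj 8 (by norm_num) le_rfl
  rw [e01, e0] at f0
  rw [e12] at f1
  rw [e24] at f2
  rw [e48] at f3
  have hu1 : Finset.Ioc (16 ^ b) (2 * L0) ∪ Finset.Ioc (2 * L0) (4 * L0) = Finset.Ioc (16 ^ b) (4 * L0) :=
    Finset.Ioc_union_Ioc_eq_Ioc (by rw [hL0def]; omega) (by omega)
  have hu2 : Finset.Ioc (4 * L0) (8 * L0) ∪ Finset.Ioc (8 * L0) (16 ^ (b + 1)) = Finset.Ioc (4 * L0) (16 ^ (b + 1)) :=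
    Finset.Ioc_union_Ioc_eq_Ioc (by omega) (by rw [← e48]; omega)
  have hu3 : Finset.Ioc (16 ^ b) (4 * L0) ∪ Finset.Ioc (4 * L0) (16 ^ (b + 1)) = Finset.Ioc (16 ^ b) (16 ^ (b + 1)) :=
    Finset.Ioc_union_Ioc_eq_Ioc (by rw [hL0def]; omega) (by rw [← e48]; omega)
  have e1 := dps_union_le W (hdisj _ _ _ _ le_rfl) (fun _ ↦ (1 : ℂ))
    (G₁ := Finset.Ioc (16 ^ b) (2 * L0)) (G₂ := Finset.Ioc (2 * L0) (4 * L0))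
  rw [hu1] at e1
  have e2 := dps_union_le W (hdisj _ _ _ _ le_rfl) (fun _ ↦ (1 : ℂ))
    (G₁ := Finset.Ioc (4 * L0) (8 * L0)) (G₂ := Finset.Ioc (8 * L0) (16 ^ (b + 1)))
  rw [hu2] at e2
  have e3 := dps_union_le W (hdisj _ _ _ _ le_rfl) (fun _ ↦ (1 : ℂ))
    (G₁ := Finset.Ioc (16 ^ b) (4 * L0)) (G₂ := Finset.Ioc (4 * L0) (16 ^ (b + 1)))
  rw [hu3] at e3
  have hsum : dps W (Finset.Ioc (16 ^ b) (16 ^ (b + 1))) (fun _ ↦ (1 : ℂ)) ≤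
      16 * (Ch * T ^ ε' * (R ^ 2 * (8 * (M : ℝ) ^ 4) + R * (8 * (M : ℝ) ^ 4) ^ 2 +
        R ^ (5 / 4 : ℝ) * T ^ (1 / 2 : ℝ) * (8 * (M : ℝ) ^ 4))) := by
    linarith
  refine hsum.trans (le_of_eq ?_)
  ring

/-- `X^{1/4} ≤ R^{1/2}M + 2R^{1/4}M² + R^{5/16}T^{1/8}M` for
`X = R²M⁴ + 8RM⁸ + R^{5/4}T^{1/2}M⁴` (`R, M, T ≥ 0`). [folklore] -/
theorem rpow_quarter_le {R M T : ℝ} (hR : 0 ≤ R) (hM : 0 ≤ M) (hT : 0 ≤ T) :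
    (R ^ 2 * M ^ 4 + 8 * (R * M ^ 8) + R ^ (5 / 4 : ℝ) * T ^ (1 / 2 : ℝ) * M ^ 4) ^ (1 / 4 : ℝ) ≤
      R ^ (1 / 2 : ℝ) * M + 2 * R ^ (1 / 4 : ℝ) * M ^ 2 + R ^ (5 / 16 : ℝ) * T ^ (1 / 8 : ℝ) * M := by
  have hq : (0 : ℝ) ≤ 1 / 4 := by norm_num
  have hq1 : (1 / 4 : ℝ) ≤ 1 := by norm_num
  have hx1 : 0 ≤ R ^ 2 * M ^ 4 := by positivity
  have hx2 : 0 ≤ 8 * (R * M ^ 8) := by positivity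
  have hx3 : 0 ≤ R ^ (5 / 4 : ℝ) * T ^ (1 / 2 : ℝ) * M ^ 4 := by positivity
  have e1 : (R ^ 2 * M ^ 4) ^ (1 / 4 : ℝ) = R ^ (1 / 2 : ℝ) * M := by
    rw [Real.mul_rpow (by positivity) (by positivity), pow_rpow_eq hR, pow_rpow_eq hM]
    norm_num
  have e2 : (8 * (R * M ^ 8)) ^ (1 / 4 : ℝ) ≤ 2 * R ^ (1 / 4 : ℝ) * M ^ 2 := by
    rw [Real.mul_rpow (by norm_num) (by positivity), Real.mul_rpow hR (by positivity), pow_rpow_eq hM]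
    have h8 : (8 : ℝ) ^ (1 / 4 : ℝ) ≤ 2 := by
      have h16 : (8 : ℝ) ≤ 2 ^ (4 : ℝ) := by norm_num
      calc (8 : ℝ) ^ (1 / 4 : ℝ) ≤ (2 ^ (4 : ℝ)) ^ (1 / 4 : ℝ) := Real.rpow_le_rpow (by norm_num) h16 hq
        _ = 2 := by rw [← Real.rpow_mul (by norm_num)]; norm_num
    have hM8 : M ^ (((8 : ℕ) : ℝ) * (1 / 4 : ℝ)) = M ^ 2 := by
      rw [show ((8 : ℕ) : ℝ) * (1 / 4 : ℝ) = ((2 : ℕ) : ℝ) by norm_num, Real.rpow_natCast]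
    rw [hM8, ← mul_assoc]
    exact mul_le_mul_of_nonneg_right (mul_le_mul_of_nonneg_right h8 (by positivity)) (by positivity)
  have e3 : (R ^ (5 / 4 : ℝ) * T ^ (1 / 2 : ℝ) * M ^ 4) ^ (1 / 4 : ℝ) =
      R ^ (5 / 16 : ℝ) * T ^ (1 / 8 : ℝ) * M := by
    rw [Real.mul_rpow (by positivity) (by positivity), Real.mul_rpow (by positivity) (by positivity),
      ← Real.rpow_mul hR, ← Real.rpow_mul hT, pow_rpow_eq hM]
    norm_num
  calc (R ^ 2 * M ^ 4 + 8 * (R * M ^ 8) + R ^ (5 / 4 : ℝ) * T ^ (1 / 2 : ℝ) * M ^ 4) ^ (1 / 4 : ℝ)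
      ≤ (R ^ 2 * M ^ 4 + 8 * (R * M ^ 8)) ^ (1 / 4 : ℝ) +
        (R ^ (5 / 4 : ℝ) * T ^ (1 / 2 : ℝ) * M ^ 4) ^ (1 / 4 : ℝ) :=
        Real.rpow_add_le_add_rpow (by positivity) hx3 hq hq1
    _ ≤ ((R ^ 2 * M ^ 4) ^ (1 / 4 : ℝ) + (8 * (R * M ^ 8)) ^ (1 / 4 : ℝ)) +
        (R ^ (5 / 4 : ℝ) * T ^ (1 / 2 : ℝ) * M ^ 4) ^ (1 / 4 : ℝ) := by
        gcongr
        exact Real.rpow_add_le_add_rpow hx1 hx2 hq hq1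
    _ ≤ R ^ (1 / 2 : ℝ) * M + 2 * R ^ (1 / 4 : ℝ) * M ^ 2 + R ^ (5 / 16 : ℝ) * T ^ (1 / 8 : ℝ) * M := by
        rw [e1, e3]; linarith [e2]

set_option maxHeartbeats 1000000 in
/-- **One dyadic block in `m`**: for `F_b = {m ∈ (1, M] : ⌊log₂(m−1)⌋ = b}` (`2^b ≤ M`), unimodular `a`,
the divisor bound `d(n) ≤ C_d n^η`, and Heath-Brown's theorem for `T` in the form `hCh`,
`dps W F_b a ≤ |W|^{3/2}·(C_d 16^η M^{2η})·(C_d 256^η M^{4η})^{1/2}·(128 C_h)^{1/4} T^{ε'/4}·(|W|^{1/2}M + 2|W|^{1/4}M² + |W|^{5/16}T^{1/8}M)`.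
[cite: GuthMaynard2026, Section 6, (6.3)–(6.5)] -/
theorem dps_block_le {Ch ε' Cd η : ℝ} (hCh0 : 0 ≤ Ch) (hCd0 : 0 ≤ Cd) (hη : 0 < η)
    (hCd : ∀ n : ℕ, (n.divisors.card : ℝ) ≤ Cd * (n : ℝ) ^ η) {T : ℝ} (hT0 : 0 ≤ T) (W : Finset ℝ)
    (hCh : ∀ (L : ℕ), 1 ≤ L →
      dps W (Finset.Ioc L (2 * L)) (fun _ ↦ (1 : ℂ)) ≤
        Ch * T ^ ε' * ((W.card : ℝ) ^ 2 * L + (W.card : ℝ) * (L : ℝ) ^ 2 +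
          (W.card : ℝ) ^ (5 / 4 : ℝ) * T ^ (1 / 2 : ℝ) * L))
    {M b : ℕ} (hM : 1 ≤ M) (h2b : (2 : ℝ) ^ b ≤ M)
    {a : ℕ → ℂ} (ha : ∀ m : ℕ, 1 ≤ m → ‖a m‖ ≤ 1) :
    dps W ((Finset.Ioc 1 M).filter (fun m ↦ Nat.log 2 (m - 1) = b)) a ≤
      (W.card : ℝ) ^ (3 / 2 : ℝ) * (Cd * 16 ^ η * (M : ℝ) ^ (2 * η)) *
        (Cd * 256 ^ η * (M : ℝ) ^ (4 * η)) ^ (1 / 2 : ℝ) *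
        ((128 * Ch) ^ (1 / 4 : ℝ) * T ^ (ε' / 4) *
          ((W.card : ℝ) ^ (1 / 2 : ℝ) * M + 2 * (W.card : ℝ) ^ (1 / 4 : ℝ) * (M : ℝ) ^ 2 +
            (W.card : ℝ) ^ (5 / 16 : ℝ) * T ^ (1 / 8 : ℝ) * M)) := by
  classical
  set R : ℝ := (W.card : ℝ) with hR
  have hR0 : 0 ≤ R := Nat.cast_nonneg _
  have hM0 : (0 : ℝ) < M := by exact_mod_cast hM
  set F := (Finset.Ioc 1 M).filter (fun m ↦ Nat.log 2 (m - 1) = b) with hF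
  set G₂ : Finset ℕ := Finset.Ioc (4 ^ b) (4 ^ (b + 1)) with hG₂
  set G₄ : Finset ℕ := Finset.Ioc (16 ^ b) (16 ^ (b + 1)) with hG₄
  have hF0 : 0 ∉ F := fun h ↦ by have := (mem_block h).1; omega
  have hG₂0 : 0 ∉ G₂ := by rw [hG₂, Finset.mem_Ioc]; omega
  have hG₄0 : 0 ∉ G₄ := by rw [hG₄, Finset.mem_Ioc]; omega
  have hFG : ∀ n ∈ F, ∀ m ∈ F, n * m ∈ G₂ := by
    intro n hn m hm
    obtain ⟨-, -, hn1, hn2⟩ := mem_block hn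
    obtain ⟨-, -, hm1, hm2⟩ := mem_block hm
    rw [hG₂, Finset.mem_Ioc, four_pow_eq, four_pow_eq]
    constructor
    · calc 2 ^ b * 2 ^ b < (2 ^ b + 1) * (2 ^ b + 1) := Nat.mul_self_lt_mul_self (Nat.lt_succ_self _)
        _ ≤ n * m := Nat.mul_le_mul hn1 hm1
    · exact Nat.mul_le_mul hn2 hm2
  have hGG : ∀ n ∈ G₂, ∀ m ∈ G₂, n * m ∈ G₄ := by
    intro n hn m hm
    rw [hG₂, Finset.mem_Ioc] at hn hm
    rw [hG₄, Finset.mem_Ioc, sixteen_pow_eq, sixteen_pow_eq]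
    constructor
    · calc 4 ^ b * 4 ^ b < (4 ^ b + 1) * (4 ^ b + 1) := Nat.mul_self_lt_mul_self (Nat.lt_succ_self _)
        _ ≤ n * m := Nat.mul_le_mul hn.1 hm.1
    · exact Nat.mul_le_mul hn.2 hm.2
  -- divisor bounds on `G₂`, `G₄`
  have hpow4 : ((4 ^ (b + 1) : ℕ) : ℝ) ≤ 16 * (M : ℝ) ^ 2 := by
    push_cast
    rw [pow_succ]
    have : (4 : ℝ) ^ b = (2 ^ b) ^ 2 := by rw [← pow_mul, mul_comm, pow_mul]; norm_num
    rw [this]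
    nlinarith [pow_le_pow_left₀ (by positivity) h2b 2, pow_nonneg (by norm_num : (0:ℝ) ≤ 2 ^ b) 2]
  have hpow16 : ((16 ^ (b + 1) : ℕ) : ℝ) ≤ 256 * (M : ℝ) ^ 4 := by
    push_cast
    rw [pow_succ, sixteen_pow_eq_real]
    nlinarith [pow_le_pow_left₀ (by positivity) h2b 4, pow_nonneg (by norm_num : (0:ℝ) ≤ 2 ^ b) 4]
  have hD₂ : ∀ k ∈ G₂, (k.divisors.card : ℝ) ≤ Cd * 16 ^ η * (M : ℝ) ^ (2 * η) := by
    intro k hk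
    rw [hG₂, Finset.mem_Ioc] at hk
    refine (hCd k).trans ?_
    rw [mul_assoc]
    refine mul_le_mul_of_nonneg_left ?_ hCd0
    have hk' : (k : ℝ) ≤ 16 * (M : ℝ) ^ 2 := le_trans (by exact_mod_cast hk.2) hpow4
    calc (k : ℝ) ^ η ≤ (16 * (M : ℝ) ^ 2) ^ η := Real.rpow_le_rpow (Nat.cast_nonneg k) hk' hη.le
      _ = 16 ^ η * (M : ℝ) ^ (2 * η) := by
          rw [Real.mul_rpow (by norm_num) (by positivity), pow_rpow_eq hM0.le]; norm_num
  have hD₄ : ∀ k ∈ G₄, (k.divisors.card : ℝ) ≤ Cd * 256 ^ η * (M : ℝ) ^ (4 * η) := by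
    intro k hk
    rw [hG₄, Finset.mem_Ioc] at hk
    refine (hCd k).trans ?_
    rw [mul_assoc]
    refine mul_le_mul_of_nonneg_left ?_ hCd0
    have hk' : (k : ℝ) ≤ 256 * (M : ℝ) ^ 4 := le_trans (by exact_mod_cast hk.2) hpow16
    calc (k : ℝ) ^ η ≤ (256 * (M : ℝ) ^ 4) ^ η := Real.rpow_le_rpow (Nat.cast_nonneg k) hk' hη.le
      _ = 256 ^ η * (M : ℝ) ^ (4 * η) := by
          rw [Real.mul_rpow (by norm_num) (by positivity), pow_rpow_eq hM0.le]; norm_num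
  have hmain := dps_le_fourth_root W hF0 hG₂0 hG₄0 hFG hGG (fun n hn ↦ ha n (by have := (mem_block hn).1; omega))
    (by positivity) (by positivity) hD₂ hD₄
  refine hmain.trans (mul_le_mul_of_nonneg_left ?_ (by positivity))
  -- Heath-Brown on `G₄` and the fourth root
  set X : ℝ := R ^ 2 * (M : ℝ) ^ 4 + 8 * (R * (M : ℝ) ^ 8) + R ^ (5 / 4 : ℝ) * T ^ (1 / 2 : ℝ) * (M : ℝ) ^ 4
    with hX
  have hX0 : 0 ≤ X := by positivity
  have hQ : dps W G₄ (fun _ ↦ (1 : ℂ)) ≤ 128 * Ch * T ^ ε' * X :=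
    dps_sixteen_range_le hCh0 hT0 W hCh h2b
  have hQ0 : 0 ≤ dps W G₄ (fun _ ↦ (1 : ℂ)) := dps_nonneg _ _ _
  have eT : (T ^ ε') ^ (1 / 4 : ℝ) = T ^ (ε' / 4) := by
    rw [← Real.rpow_mul hT0]; ring_nf
  calc (dps W G₄ (fun _ ↦ (1 : ℂ))) ^ (1 / 4 : ℝ) ≤ (128 * Ch * T ^ ε' * X) ^ (1 / 4 : ℝ) :=
        Real.rpow_le_rpow hQ0 hQ (by norm_num)
    _ = (128 * Ch) ^ (1 / 4 : ℝ) * T ^ (ε' / 4) * X ^ (1 / 4 : ℝ) := by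
        rw [Real.mul_rpow (by positivity) hX0, Real.mul_rpow (by positivity) (by positivity), eT]
    _ ≤ (128 * Ch) ^ (1 / 4 : ℝ) * T ^ (ε' / 4) *
        (R ^ (1 / 2 : ℝ) * M + 2 * R ^ (1 / 4 : ℝ) * (M : ℝ) ^ 2 + R ^ (5 / 16 : ℝ) * T ^ (1 / 8 : ℝ) * M) :=
        mul_le_mul_of_nonneg_left (rpow_quarter_le hR0 hM0.le hT0) (by positivity)

set_option maxHeartbeats 1000000 in
/-- **The double zeta sums of the length-`M` polynomials from Heath-Brown's theorem (the steps
(6.3)–(6.5) of the paper with `k = 4`).** For every `ε > 0` there are `C, T₀` such that for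
`T ≥ T₀`, `1 ≤ M ≤ T`, every finite `1`-separated `W` in an interval of length `T` and every real `ξ`,
`∑_{t,t'∈W} |D_M(t−t'+2πξ)|² ≤ C T^ε (M|W|² + M²|W|^{7/4} + M T^{1/8}|W|^{29/16})`
(the element `m = 1` apart, dyadic blocks `(2^b, 2^{b+1}]` in `m`, Cauchy–Schwarz twice in place of
Hölder with `k = 4`, the divisor bound for the coefficients of the fourth power, and the tree's
Heath-Brown theorem `HeathBrownDZS.heathBrown_differenceSet` on the four dyadic ranges covering
`(16^b, 16^{b+1}]`): "Substituting (6.3) and (6.4) back into (6.2) …".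
[cite: GuthMaynard2026, Section 6, (6.3)–(6.5)] -/
theorem sum_sq_norm_dirD_le {ε : ℝ} (hε : 0 < ε) : ∃ C T₀ : ℝ, 0 ≤ C ∧ ∀ (T : ℝ), T₀ ≤ T →
      ∀ (M : ℕ), 1 ≤ M → (M : ℝ) ≤ T → ∀ (W : Finset ℝ) (T₁ : ℝ), (∀ t ∈ W, T₁ ≤ t ∧ t ≤ T₁ + T) →
      (∀ t ∈ W, ∀ t' ∈ W, t ≠ t' → 1 ≤ |t - t'|) → ∀ ξ : ℝ,
      ∑ t ∈ W, ∑ t' ∈ W, ‖dirD M (t - t' + 2 * π * ξ)‖ ^ 2 ≤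
        C * T ^ ε * ((M : ℝ) * (W.card : ℝ) ^ 2 + (M : ℝ) ^ 2 * (W.card : ℝ) ^ (7 / 4 : ℝ) +
          (M : ℝ) * T ^ (1 / 8 : ℝ) * (W.card : ℝ) ^ (29 / 16 : ℝ)) := by
  classical
  -- parameters: `η = ε/16` for the divisor bound and the number of blocks, `ε/2` for Heath-Brown
  set η : ℝ := ε / 16 with hη
  have hη0 : 0 < η := by positivity
  obtain ⟨Cd, hCd1, hCd⟩ := Literature.NumberTheory.Sieve.exists_card_divisors_le_mul_rpow' hη0
  obtain ⟨T₀, hT₀⟩ := HeathBrownDZS.heathBrown_differenceSet (half_pos hε)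
  have hCd0 : 0 ≤ Cd := by linarith
  set Cη : ℝ := 1 / (η * Real.log 2) + 1 with hCη
  have hCη0 : 0 ≤ Cη := by positivity
  set K₀ : ℝ := (Cd * 16 ^ η) * (Cd * 256 ^ η) ^ (1 / 2 : ℝ) * (128 * 2) ^ (1 / 4 : ℝ) with hK₀
  have hK₀0 : 0 ≤ K₀ := by positivity
  refine ⟨Cη ^ 2 * K₀ * 4 + 2, max T₀ 2, by positivity, fun T hT M hM hMT1 W T₁ hwin hsep ξ ↦ ?_⟩
  have hTT₀ : T₀ ≤ T := le_trans (le_max_left _ _) hT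
  have hT2 : 2 ≤ T := le_trans (le_max_right _ _) hT
  have hT0 : 0 < T := by linarith
  have hT1 : (1 : ℝ) ≤ T := by linarith
  have hM0 : (0 : ℝ) < M := by exact_mod_cast hM
  have hM1 : (1 : ℝ) ≤ M := by exact_mod_cast hM
  set R : ℝ := (W.card : ℝ) with hR
  have hR0 : 0 ≤ R := Nat.cast_nonneg _
  -- Heath-Brown for this `W`, coefficients `1`
  have hCh : ∀ (L : ℕ), 1 ≤ L → dps W (Finset.Ioc L (2 * L)) (fun _ ↦ (1 : ℂ)) ≤
      2 * T ^ (ε / 2) * (R ^ 2 * L + R * (L : ℝ) ^ 2 + R ^ (5 / 4 : ℝ) * T ^ (1 / 2 : ℝ) * L) := by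
    intro L hL
    have h := hT₀ T hTT₀ W T₁ hwin hsep L hL (fun _ ↦ (1 : ℂ)) (fun _ ↦ by simp)
    exact h
  -- Step 1: the sum is a double zeta sum with unimodular coefficients
  set a : ℕ → ℂ := fun m ↦ ePow (-(((2 * π * ξ : ℝ) : ℂ) * I)) m with ha
  have ha1 : ∀ m : ℕ, 1 ≤ m → ‖a m‖ ≤ 1 := fun m hm ↦ (norm_ePow_coeff hm ξ).le
  have hdps : ∑ t ∈ W, ∑ t' ∈ W, ‖dirD M (t - t' + 2 * π * ξ)‖ ^ 2 = dps W (Finset.Icc 1 M) a := by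
    rw [dps_eq_swap]
    refine Finset.sum_congr rfl fun t _ ↦ Finset.sum_congr rfl fun t' _ ↦ ?_
    rw [dirD_sub_add]
    rfl
  rw [hdps]
  -- Step 2: split off `m = 1` and cut `(1, M]` into dyadic blocks
  have hsplit : Finset.Icc 1 M = {1} ∪ Finset.Ioc 1 M := by
    ext m; simp only [Finset.mem_union, Finset.mem_singleton, Finset.mem_Icc, Finset.mem_Ioc]; omega
  have hdisj : Disjoint ({1} : Finset ℕ) (Finset.Ioc 1 M) := by
    rw [Finset.disjoint_singleton_left, Finset.mem_Ioc]; omega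
  have hone : dps W ({1} : Finset ℕ) a ≤ R ^ 2 := by
    unfold dps
    have : ∀ t ∈ W, ∀ t' ∈ W, ‖∑ n ∈ ({1} : Finset ℕ), a n * twist n (t - t')‖ ^ 2 ≤ 1 := by
      intro t _ t' _
      rw [Finset.sum_singleton, norm_mul]
      have h1 : ‖a 1‖ ≤ 1 := ha1 1 le_rfl
      have h2 : ‖twist 1 (t - t')‖ ≤ 1 := norm_twist_le 1 _
      exact pow_le_one₀ (by positivity) (mul_le_one₀ h1 (norm_nonneg _) h2)
    calc ∑ t ∈ W, ∑ t' ∈ W, ‖∑ n ∈ ({1} : Finset ℕ), a n * twist n (t - t')‖ ^ 2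
        ≤ ∑ t ∈ W, ∑ t' ∈ W, (1 : ℝ) := Finset.sum_le_sum fun t ht ↦ Finset.sum_le_sum fun t' ht' ↦ this t ht t' ht'
      _ = R ^ 2 := by simp [hR]; ring
  set B : ℕ := Nat.log 2 M with hB
  set S : Finset ℕ := Finset.range (B + 1) with hS
  have hpart : ∀ m ∈ Finset.Ioc 1 M, Nat.log 2 (m - 1) ∈ S := by
    intro m hm
    rw [Finset.mem_Ioc] at hm
    rw [hS, Finset.mem_range]
    exact Nat.lt_succ_of_le (Nat.log_mono_right (by omega))
  have hblocks := dps_le_card_mul_sum_filter W (Finset.Ioc 1 M) a S (fun m ↦ Nat.log 2 (m - 1)) hpart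
  have hScard : (S.card : ℝ) = B + 1 := by rw [hS, Finset.card_range]; push_cast; ring
  have hB1 : (B : ℝ) + 1 ≤ Cη * (M : ℝ) ^ η := natLog_add_one_le hη0 hM
  have h2B : (2 : ℝ) ^ B ≤ M := by exact_mod_cast Nat.pow_log_le_self 2 (by omega : M ≠ 0)
  -- Step 3: each block
  set Mη : ℝ := (M : ℝ) ^ (2 * η) with hMη
  have hMη0 : 0 ≤ Mη := by positivity
  have hMη1 : 1 ≤ Mη := Real.one_le_rpow hM1 (by positivity)
  set Lin : ℝ := R ^ (1 / 2 : ℝ) * M + 2 * R ^ (1 / 4 : ℝ) * (M : ℝ) ^ 2 + R ^ (5 / 16 : ℝ) * T ^ (1 / 8 : ℝ) * M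
    with hLin
  have hLin0 : 0 ≤ Lin := by positivity
  have hsqrt : (Cd * 256 ^ η * (M : ℝ) ^ (4 * η)) ^ (1 / 2 : ℝ) = (Cd * 256 ^ η) ^ (1 / 2 : ℝ) * Mη := by
    rw [Real.mul_rpow (by positivity) (by positivity), ← Real.rpow_mul hM0.le, hMη]; ring_nf
  have hblock : ∀ b ∈ S, dps W ((Finset.Ioc 1 M).filter (fun m ↦ Nat.log 2 (m - 1) = b)) a ≤
      R ^ (3 / 2 : ℝ) * K₀ * (Mη * Mη * T ^ (ε / 8)) * Lin := by
    intro b hb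
    rw [hS, Finset.mem_range] at hb
    have h2b : (2 : ℝ) ^ b ≤ M := le_trans (pow_le_pow_right₀ one_le_two (Nat.lt_succ_iff.mp hb)) h2B
    have h := dps_block_le (Ch := 2) (ε' := ε / 2) zero_le_two hCd0 hη0 hCd hT0.le W hCh hM h2b ha1 (b := b)
    refine h.trans (le_of_eq ?_)
    rw [hsqrt, hK₀, hLin, hMη, show ε / 2 / 4 = ε / 8 by ring]
    ring
  -- Step 4: sum over the blocks
  have hsumb : ∑ b ∈ S, dps W ((Finset.Ioc 1 M).filter (fun m ↦ Nat.log 2 (m - 1) = b)) a ≤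
      (B + 1 : ℝ) * (R ^ (3 / 2 : ℝ) * K₀ * (Mη * Mη * T ^ (ε / 8)) * Lin) := by
    refine (Finset.sum_le_sum hblock).trans (le_of_eq ?_)
    rw [Finset.sum_const, nsmul_eq_mul, hScard]
  have hIoc : dps W (Finset.Ioc 1 M) a ≤ ((B : ℝ) + 1) * (((B : ℝ) + 1) * (R ^ (3 / 2 : ℝ) * K₀ *
      (Mη * Mη * T ^ (ε / 8)) * Lin)) := by
    refine hblocks.trans ?_
    rw [hScard]
    exact mul_le_mul_of_nonneg_left hsumb (by positivity)
  -- Step 5: collect the losses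
  have hB2 : ((B : ℝ) + 1) * ((B : ℝ) + 1) ≤ Cη ^ 2 * Mη := by
    have h0 : 0 ≤ (B : ℝ) + 1 := by positivity
    calc ((B : ℝ) + 1) * ((B : ℝ) + 1) ≤ (Cη * (M : ℝ) ^ η) * (Cη * (M : ℝ) ^ η) :=
          mul_le_mul hB1 hB1 h0 (by positivity)
      _ = Cη ^ 2 * ((M : ℝ) ^ η * (M : ℝ) ^ η) := by ring
      _ = Cη ^ 2 * Mη := by rw [← Real.rpow_add hM0, hMη]; ring_nf
  have hMpow : Mη * Mη * Mη * T ^ (ε / 8) ≤ T ^ ε := by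
    have h1 : Mη ≤ T ^ (2 * η) := Real.rpow_le_rpow hM0.le hMT1 (by positivity)
    calc Mη * Mη * Mη * T ^ (ε / 8) ≤ T ^ (2 * η) * T ^ (2 * η) * T ^ (2 * η) * T ^ (ε / 8) := by gcongr
      _ = T ^ (ε / 2) := by
          rw [← Real.rpow_add hT0, ← Real.rpow_add hT0, ← Real.rpow_add hT0, hη]; ring_nf
      _ ≤ T ^ ε := Real.rpow_le_rpow_of_exponent_le hT1 (by linarith)
  have eR1 : R ^ (3 / 2 : ℝ) * R ^ (1 / 2 : ℝ) = R ^ 2 := by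
    rw [← Real.rpow_add' hR0 (by norm_num)]; norm_num
  have eR2 : R ^ (3 / 2 : ℝ) * R ^ (1 / 4 : ℝ) = R ^ (7 / 4 : ℝ) := by
    rw [← Real.rpow_add' hR0 (by norm_num)]; norm_num
  have eR3 : R ^ (3 / 2 : ℝ) * R ^ (5 / 16 : ℝ) = R ^ (29 / 16 : ℝ) := by
    rw [← Real.rpow_add' hR0 (by norm_num)]; norm_num
  set Y : ℝ := (M : ℝ) * R ^ 2 + (M : ℝ) ^ 2 * R ^ (7 / 4 : ℝ) + (M : ℝ) * T ^ (1 / 8 : ℝ) * R ^ (29 / 16 : ℝ)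
    with hY
  have hY0 : 0 ≤ Y := by positivity
  have hlin : R ^ (3 / 2 : ℝ) * Lin ≤ 2 * Y := by
    have : R ^ (3 / 2 : ℝ) * Lin =
        (M : ℝ) * R ^ 2 + 2 * ((M : ℝ) ^ 2 * R ^ (7 / 4 : ℝ)) + (M : ℝ) * T ^ (1 / 8 : ℝ) * R ^ (29 / 16 : ℝ) := by
      rw [hLin, ← eR1, ← eR2, ← eR3]; ring
    rw [this, hY]
    have h1 : 0 ≤ (M : ℝ) * R ^ 2 := by positivity
    have h2 : 0 ≤ (M : ℝ) * T ^ (1 / 8 : ℝ) * R ^ (29 / 16 : ℝ) := by positivity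
    linarith
  have hIoc' : dps W (Finset.Ioc 1 M) a ≤ Cη ^ 2 * K₀ * 2 * T ^ ε * Y := by
    refine hIoc.trans ?_
    calc ((B : ℝ) + 1) * (((B : ℝ) + 1) * (R ^ (3 / 2 : ℝ) * K₀ * (Mη * Mη * T ^ (ε / 8)) * Lin))
        = (((B : ℝ) + 1) * ((B : ℝ) + 1)) * (K₀ * (Mη * Mη * T ^ (ε / 8))) * (R ^ (3 / 2 : ℝ) * Lin) := by ring
      _ ≤ (Cη ^ 2 * Mη) * (K₀ * (Mη * Mη * T ^ (ε / 8))) * (2 * Y) :=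
          mul_le_mul (mul_le_mul_of_nonneg_right hB2 (by positivity)) hlin (by positivity) (by positivity)
      _ = Cη ^ 2 * K₀ * 2 * (Mη * Mη * Mη * T ^ (ε / 8)) * Y := by ring
      _ ≤ Cη ^ 2 * K₀ * 2 * T ^ ε * Y :=
          mul_le_mul_of_nonneg_right (mul_le_mul_of_nonneg_left hMpow (by positivity)) hY0
  -- the element `m = 1`: `R² ≤ T^ε · Y` (`M ≥ 1`, `T ≥ 1`)
  have hTε : (1 : ℝ) ≤ T ^ ε := Real.one_le_rpow hT1 hε.le
  have hone' : dps W ({1} : Finset ℕ) a ≤ T ^ ε * Y := by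
    refine hone.trans ?_
    have h1 : R ^ 2 ≤ Y := by
      rw [hY]
      have : R ^ 2 ≤ (M : ℝ) * R ^ 2 := le_mul_of_one_le_left (by positivity) hM1
      have h2 : 0 ≤ (M : ℝ) ^ 2 * R ^ (7 / 4 : ℝ) := by positivity
      have h3 : 0 ≤ (M : ℝ) * T ^ (1 / 8 : ℝ) * R ^ (29 / 16 : ℝ) := by positivity
      linarith
    calc R ^ 2 ≤ Y := h1
      _ ≤ T ^ ε * Y := le_mul_of_one_le_left hY0 hTε
  rw [hsplit]
  refine (dps_union_le W hdisj a).trans ?_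
  calc 2 * (dps W ({1} : Finset ℕ) a + dps W (Finset.Ioc 1 M) a)
      ≤ 2 * (T ^ ε * Y + Cη ^ 2 * K₀ * 2 * T ^ ε * Y) := by linarith [hone', hIoc']
    _ = (Cη ^ 2 * K₀ * 4 + 2) * T ^ ε * Y := by ring

/-! ## §8. Proposition 6.1: the bound for `S₂` -/

section weight

variable {w : ℝ → ℝ}

/-- **The cyclic symmetry of `S₂`**: the three terms of `S₂` (exactly two of `m₁, m₂, m₃` non-zero)
are equal after relabelling, `S₂ = 3N³ ∑_{t₁,t₂,t₃} B(t₁−t₂)B(t₂−t₃)A(t₃−t₁)`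
("By symmetry, we have `S₂ = 3N³ ∑_{m₁,m₂≠0} ∑_{t₁,t₂,t₃} ĥ_{t₁−t₂}(m₁N)ĥ_{t₂−t₃}(m₂N)ĥ_{t₃−t₁}(0)`").
[cite: GuthMaynard2026, Section 6, proof of Proposition 6.1] -/
theorem S2_eq_three_mul (w : ℝ → ℝ) (N : ℕ) (W : Finset ℝ) :
    S2 w N W = 3 * (N : ℂ) ^ 3 * ∑ t₁ ∈ W, ∑ t₂ ∈ W, ∑ t₃ ∈ W,
      coefB w N (t₁ - t₂) * coefB w N (t₂ - t₃) * coefA w (t₃ - t₁) := by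
  set g : ℝ → ℝ → ℝ → ℂ := fun x y z ↦ coefB w N (x - y) * coefB w N (y - z) * coefA w (z - x) with hg
  have h2 : ∑ t₁ ∈ W, ∑ t₂ ∈ W, ∑ t₃ ∈ W, coefB w N (t₁ - t₂) * coefA w (t₂ - t₃) * coefB w N (t₃ - t₁) =
      ∑ t₁ ∈ W, ∑ t₂ ∈ W, ∑ t₃ ∈ W, g t₁ t₂ t₃ := by
    calc ∑ t₁ ∈ W, ∑ t₂ ∈ W, ∑ t₃ ∈ W, coefB w N (t₁ - t₂) * coefA w (t₂ - t₃) * coefB w N (t₃ - t₁)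
        = ∑ t₁ ∈ W, ∑ t₂ ∈ W, ∑ t₃ ∈ W, g t₃ t₁ t₂ :=
          Finset.sum_congr rfl fun _ _ ↦ Finset.sum_congr rfl fun _ _ ↦ Finset.sum_congr rfl fun _ _ ↦ by
            simp only [hg]; ring
      _ = ∑ t₁ ∈ W, ∑ t₃ ∈ W, ∑ t₂ ∈ W, g t₃ t₁ t₂ := Finset.sum_congr rfl fun _ _ ↦ Finset.sum_comm
      _ = ∑ t₃ ∈ W, ∑ t₁ ∈ W, ∑ t₂ ∈ W, g t₃ t₁ t₂ := Finset.sum_comm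
  have h3 : ∑ t₁ ∈ W, ∑ t₂ ∈ W, ∑ t₃ ∈ W, coefA w (t₁ - t₂) * coefB w N (t₂ - t₃) * coefB w N (t₃ - t₁) =
      ∑ t₁ ∈ W, ∑ t₂ ∈ W, ∑ t₃ ∈ W, g t₁ t₂ t₃ := by
    calc ∑ t₁ ∈ W, ∑ t₂ ∈ W, ∑ t₃ ∈ W, coefA w (t₁ - t₂) * coefB w N (t₂ - t₃) * coefB w N (t₃ - t₁)
        = ∑ t₁ ∈ W, ∑ t₂ ∈ W, ∑ t₃ ∈ W, g t₂ t₃ t₁ :=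
          Finset.sum_congr rfl fun _ _ ↦ Finset.sum_congr rfl fun _ _ ↦ Finset.sum_congr rfl fun _ _ ↦ by
            simp only [hg]; ring
      _ = ∑ t₂ ∈ W, ∑ t₁ ∈ W, ∑ t₃ ∈ W, g t₂ t₃ t₁ := Finset.sum_comm
      _ = ∑ t₂ ∈ W, ∑ t₃ ∈ W, ∑ t₁ ∈ W, g t₂ t₃ t₁ := Finset.sum_congr rfl fun _ _ ↦ Finset.sum_comm
  unfold S2
  simp only [Finset.sum_add_distrib]
  rw [h2, h3]
  simp only [hg]
  ring

/-- **`S₂` in terms of the mean square of `B_N`** (the first display of the proof of Proposition 6.1):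
for every `j` there is `C` such that for `N ≥ 1`, `δ`-separated `W` of diameter `≤ L`,
`|S₂| ≤ C N³ (∑_{t,t'∈W} |B_N(t−t')|² + |W|³(1+L)⁴δ^{-j})`: the terms with `t₃ ≠ t₁` carry a factor
`A(t₃−t₁) = ĥ_{t₃−t₁}(0) ≪_j δ^{-j}` (and `|B| ≪ (1+L)²`), while for `t₃ = t₁` the term is
`A(0)B(t₁−t₂)B(t₂−t₁)`, bounded via `2|B(τ)B(−τ)| ≤ |B(τ)|² + |B(−τ)|²` ("If `t₁ ≠ t₃`, then (5.1) shows
that the last factor is `O_ε(T^{-100})` … Therefore `S₂ = 3N³ĥ_0(0)∑_{t₁,t₂}|∑_{m≠0}ĥ_{t₁−t₂}(mN)|² + O(T^{-10})`").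
[cite: GuthMaynard2026, Section 6, proof of Proposition 6.1] -/
theorem norm_S2_le (hw : ContDiff ℝ ∞ w) (hsupp : Function.support w ⊆ Set.Icc 1 2) (j : ℕ) :
    ∃ C, 0 ≤ C ∧ ∀ (N : ℕ), 1 ≤ N → ∀ (W : Finset ℝ) (δ L : ℝ), 0 < δ → 0 ≤ L →
      (∀ t ∈ W, ∀ t' ∈ W, t ≠ t' → δ ≤ |t - t'|) → (∀ t ∈ W, ∀ t' ∈ W, |t - t'| ≤ L) →
      ‖S2 w N W‖ ≤ C * (N : ℝ) ^ 3 * (∑ t ∈ W, ∑ t' ∈ W, ‖coefB w N (t - t')‖ ^ 2 +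
        (W.card : ℝ) ^ 3 * (1 + L) ^ 4 / δ ^ j) := by
  classical
  obtain ⟨C₀, hC₀0, hC₀⟩ := norm_coefA_le hw hsupp
  obtain ⟨C₁, hC₁0, hC₁⟩ := norm_coefA_le_div hw hsupp j
  obtain ⟨C₂, hC₂0, hC₂⟩ := norm_coefB_le hw hsupp (le_refl 2)
  refine ⟨3 * max C₀ (C₂ ^ 2 * C₁), by positivity, fun N hN W δ L hδ hL hsep hdiam ↦ ?_⟩
  have hN1 : (1 : ℝ) ≤ N := by exact_mod_cast hN
  have hN0 : (0 : ℝ) < N := by linarith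
  set P : ℝ := ∑ t ∈ W, ∑ t' ∈ W, ‖coefB w N (t - t')‖ ^ 2 with hP
  have hP0 : 0 ≤ P := Finset.sum_nonneg fun _ _ ↦ Finset.sum_nonneg fun _ _ ↦ by positivity
  -- the basic bounds
  have hB : ∀ t ∈ W, ∀ t' ∈ W, ‖coefB w N (t - t')‖ ≤ C₂ * (1 + L) ^ 2 := by
    intro t ht t' ht'
    refine (hC₂ (t - t') N hN1).trans ?_
    have h1 : (1 + |t - t'|) ^ 2 ≤ (1 + L) ^ 2 := by
      have := hdiam t ht t' ht'; gcongr
    calc C₂ * (1 + |t - t'|) ^ 2 / (N : ℝ) ^ 2 ≤ C₂ * (1 + |t - t'|) ^ 2 / 1 :=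
          div_le_div_of_nonneg_left (by positivity) one_pos (one_le_pow₀ hN1)
      _ ≤ C₂ * (1 + L) ^ 2 := by rw [div_one]; gcongr
  have hA : ∀ t ∈ W, ∀ t' ∈ W, t ≠ t' → ‖coefA w (t - t')‖ ≤ C₁ / δ ^ j := by
    intro t ht t' ht' hne
    refine (hC₁ _ (sub_ne_zero.mpr hne)).trans ?_
    exact div_le_div_of_nonneg_left hC₁0 (pow_pos hδ j) (pow_le_pow_left₀ hδ.le (hsep t ht t' ht' hne) j)
  set K : ℝ := (C₂ * (1 + L) ^ 2) * (C₂ * (1 + L) ^ 2) * (C₁ / δ ^ j) with hK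
  have hK0 : 0 ≤ K := by positivity
  set h : ℝ → ℝ → ℝ := fun t₁ t₂ ↦ C₀ / 2 * (‖coefB w N (t₁ - t₂)‖ ^ 2 + ‖coefB w N (t₂ - t₁)‖ ^ 2) with hh
  -- termwise bound
  have hterm : ∀ t₁ ∈ W, ∀ t₂ ∈ W, ∀ t₃ ∈ W,
      ‖coefB w N (t₁ - t₂) * coefB w N (t₂ - t₃) * coefA w (t₃ - t₁)‖ ≤
        (if t₃ = t₁ then h t₁ t₂ else 0) + K := by
    intro t₁ h₁ t₂ h₂ t₃ h₃
    rw [norm_mul, norm_mul]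
    by_cases h31 : t₃ = t₁
    · subst h31
      rw [if_pos rfl, sub_self]
      have hA0 : ‖coefA w 0‖ ≤ C₀ := hC₀ 0
      have hx := norm_nonneg (coefB w N (t₃ - t₂))
      have hy := norm_nonneg (coefB w N (t₂ - t₃))
      have h2 : ‖coefB w N (t₃ - t₂)‖ * ‖coefB w N (t₂ - t₃)‖ * ‖coefA w 0‖ ≤ h t₃ t₂ := by
        rw [hh]
        have : ‖coefB w N (t₃ - t₂)‖ * ‖coefB w N (t₂ - t₃)‖ ≤
            (‖coefB w N (t₃ - t₂)‖ ^ 2 + ‖coefB w N (t₂ - t₃)‖ ^ 2) / 2 := by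
          nlinarith [sq_nonneg (‖coefB w N (t₃ - t₂)‖ - ‖coefB w N (t₂ - t₃)‖)]
        calc ‖coefB w N (t₃ - t₂)‖ * ‖coefB w N (t₂ - t₃)‖ * ‖coefA w 0‖
            ≤ (‖coefB w N (t₃ - t₂)‖ ^ 2 + ‖coefB w N (t₂ - t₃)‖ ^ 2) / 2 * C₀ :=
              mul_le_mul this hA0 (norm_nonneg _) (by positivity)
          _ = _ := by ring
      linarith
    · rw [if_neg h31, zero_add, hK]
      exact mul_le_mul (mul_le_mul (hB t₁ h₁ t₂ h₂) (hB t₂ h₂ t₃ h₃) (norm_nonneg _) (by positivity))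
        (hA t₃ h₃ t₁ h₁ h31) (norm_nonneg _) (by positivity)
  -- sum it
  have e1 : ∑ t₁ ∈ W, ∑ t₂ ∈ W, (h t₁ t₂ + W.card * K) =
      ∑ t₁ ∈ W, ∑ t₂ ∈ W, h t₁ t₂ + (W.card : ℝ) ^ 3 * K := by
    simp only [Finset.sum_add_distrib, Finset.sum_const, nsmul_eq_mul]; ring
  have e2 : ∑ t₁ ∈ W, ∑ t₂ ∈ W, h t₁ t₂ = C₀ * P := by
    simp only [hh, mul_add, Finset.sum_add_distrib, ← Finset.mul_sum]
    rw [show ∑ t ∈ W, ∑ t' ∈ W, ‖coefB w N (t' - t)‖ ^ 2 =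
        ∑ t ∈ W, ∑ t' ∈ W, ‖coefB w N (t - t')‖ ^ 2 from Finset.sum_comm, hP]; ring
  have hsum : ∑ t₁ ∈ W, ∑ t₂ ∈ W, ∑ t₃ ∈ W,
      ‖coefB w N (t₁ - t₂) * coefB w N (t₂ - t₃) * coefA w (t₃ - t₁)‖ ≤ C₀ * P + (W.card : ℝ) ^ 3 * K := by
    calc ∑ t₁ ∈ W, ∑ t₂ ∈ W, ∑ t₃ ∈ W, ‖coefB w N (t₁ - t₂) * coefB w N (t₂ - t₃) * coefA w (t₃ - t₁)‖
        ≤ ∑ t₁ ∈ W, ∑ t₂ ∈ W, ∑ t₃ ∈ W, ((if t₃ = t₁ then h t₁ t₂ else 0) + K) :=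
          Finset.sum_le_sum fun t₁ h₁ ↦ Finset.sum_le_sum fun t₂ h₂ ↦ Finset.sum_le_sum fun t₃ h₃ ↦
            hterm t₁ h₁ t₂ h₂ t₃ h₃
      _ = ∑ t₁ ∈ W, ∑ t₂ ∈ W, (h t₁ t₂ + W.card * K) := by
          refine Finset.sum_congr rfl fun t₁ h₁ ↦ Finset.sum_congr rfl fun t₂ _ ↦ ?_
          rw [Finset.sum_add_distrib, Finset.sum_ite_eq' W t₁, if_pos h₁, Finset.sum_const, nsmul_eq_mul]
      _ = C₀ * P + (W.card : ℝ) ^ 3 * K := by rw [e1, e2]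
  calc ‖S2 w N W‖ = 3 * (N : ℝ) ^ 3 * ‖∑ t₁ ∈ W, ∑ t₂ ∈ W, ∑ t₃ ∈ W,
        coefB w N (t₁ - t₂) * coefB w N (t₂ - t₃) * coefA w (t₃ - t₁)‖ := by
        rw [S2_eq_three_mul, norm_mul, norm_mul, norm_pow, Complex.norm_natCast]
        norm_num
    _ ≤ 3 * (N : ℝ) ^ 3 * (C₀ * P + (W.card : ℝ) ^ 3 * K) := by
        refine mul_le_mul_of_nonneg_left ?_ (by positivity)
        refine (norm_sum_le _ _).trans ((Finset.sum_le_sum fun t₁ _ ↦ norm_sum_le _ _).trans ?_)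
        refine (Finset.sum_le_sum fun t₁ _ ↦ Finset.sum_le_sum fun t₂ _ ↦ norm_sum_le _ _).trans hsum
    _ ≤ 3 * max C₀ (C₂ ^ 2 * C₁) * (N : ℝ) ^ 3 * (P + (W.card : ℝ) ^ 3 * (1 + L) ^ 4 / δ ^ j) := by
        have e : (W.card : ℝ) ^ 3 * K = (C₂ ^ 2 * C₁) * ((W.card : ℝ) ^ 3 * (1 + L) ^ 4 / δ ^ j) := by
          rw [hK]; ring
        rw [e]
        have h1 : C₀ * P ≤ max C₀ (C₂ ^ 2 * C₁) * P := mul_le_mul_of_nonneg_right (le_max_left _ _) hP0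
        have h2 : (C₂ ^ 2 * C₁) * ((W.card : ℝ) ^ 3 * (1 + L) ^ 4 / δ ^ j) ≤
            max C₀ (C₂ ^ 2 * C₁) * ((W.card : ℝ) ^ 3 * (1 + L) ^ 4 / δ ^ j) :=
          mul_le_mul_of_nonneg_right (le_max_right _ _) (by positivity)
        nlinarith [h1, h2, pow_nonneg hN0.le 3]

/-- **Decomposition of the pairs by the size of `|t − t'|`**: diagonal, small differences
`|t−t'| ≤ Θ`, and the dyadic classes `2^i ≤ |t−t'| ≤ 2^{i+1}` with `Θ < 2^{i+1}`, `i ≤ I`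
(`Θ ≥ 1`, diameter `≤ L ≤ 2^I`) ("splitting the sum dyadically according to the size of `t₁−t₂`").
[cite: GuthMaynard2026, Section 6, proof of Proposition 6.1] -/
theorem sum_pairs_le_classes (f : ℝ → ℝ) (hf : ∀ τ, 0 ≤ f τ) (W : Finset ℝ) {Θ L : ℝ} (hΘ : 1 ≤ Θ)
    {I : ℕ} (hL : L ≤ 2 ^ I) (hdiam : ∀ t ∈ W, ∀ t' ∈ W, |t - t'| ≤ L) :
    ∑ t ∈ W, ∑ t' ∈ W, f (t - t') ≤ W.card * f 0 +
      ∑ t ∈ W, ∑ t' ∈ W, (if t ≠ t' ∧ |t - t'| ≤ Θ then f (t - t') else 0) +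
      ∑ i ∈ (Finset.range (I + 1)).filter (fun i ↦ Θ < 2 ^ (i + 1)),
        ∑ t ∈ W, ∑ t' ∈ W,
          (if (2 : ℝ) ^ i ≤ |t - t'| ∧ |t - t'| ≤ 2 * 2 ^ i then f (t - t') else 0) := by
  classical
  set S := (Finset.range (I + 1)).filter (fun i ↦ Θ < 2 ^ (i + 1)) with hS
  -- termwise
  have hterm : ∀ t ∈ W, ∀ t' ∈ W, f (t - t') ≤ (if t = t' then f 0 else 0) +
      (if t ≠ t' ∧ |t - t'| ≤ Θ then f (t - t') else 0) +
      ∑ i ∈ S, (if (2 : ℝ) ^ i ≤ |t - t'| ∧ |t - t'| ≤ 2 * 2 ^ i then f (t - t') else 0) := by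
    intro t ht t' ht'
    have h3 : 0 ≤ ∑ i ∈ S, (if (2 : ℝ) ^ i ≤ |t - t'| ∧ |t - t'| ≤ 2 * 2 ^ i then f (t - t') else 0) :=
      Finset.sum_nonneg fun i _ ↦ by split_ifs <;> [exact hf _; exact le_rfl]
    by_cases heq : t = t'
    · subst heq
      simp only [if_true, sub_self]
      have h2 : 0 ≤ (if t ≠ t ∧ |(0 : ℝ)| ≤ Θ then f 0 else 0) := by split_ifs <;> [exact hf _; exact le_rfl]
      rw [sub_self] at h3
      linarith
    · rw [if_neg heq, zero_add]
      by_cases hsmall : |t - t'| ≤ Θ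
      · rw [if_pos ⟨heq, hsmall⟩]
        linarith
      · rw [if_neg (fun h ↦ hsmall h.2), zero_add]
        push Not at hsmall
        have h1 : 1 ≤ |t - t'| := hΘ.trans hsmall.le
        obtain ⟨n, hn1, hn2⟩ := exists_nat_pow_near h1 one_lt_two
        have hnI : n < I + 1 := by
          have : (2 : ℝ) ^ n < 2 ^ (I + 1) := by
            calc (2 : ℝ) ^ n ≤ |t - t'| := hn1
              _ ≤ L := hdiam t ht t' ht'
              _ ≤ 2 ^ I := hL
              _ < 2 ^ (I + 1) := pow_lt_pow_right₀ one_lt_two (Nat.lt_succ_self I)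
          exact (pow_lt_pow_iff_right₀ one_lt_two).mp this
        have hnS : n ∈ S := by
          rw [hS, Finset.mem_filter, Finset.mem_range]
          exact ⟨hnI, hsmall.trans hn2⟩
        have hle : f (t - t') ≤ (if (2 : ℝ) ^ n ≤ |t - t'| ∧ |t - t'| ≤ 2 * 2 ^ n then f (t - t') else 0) := by
          rw [if_pos ⟨hn1, by rw [pow_succ] at hn2; linarith⟩]
        refine hle.trans ?_
        exact Finset.single_le_sum (f := fun i ↦
          (if (2 : ℝ) ^ i ≤ |t - t'| ∧ |t - t'| ≤ 2 * 2 ^ i then f (t - t') else 0))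
          (fun i _ ↦ by split_ifs <;> [exact hf _; exact le_rfl]) hnS
  calc ∑ t ∈ W, ∑ t' ∈ W, f (t - t')
      ≤ ∑ t ∈ W, ∑ t' ∈ W, ((if t = t' then f 0 else 0) +
          (if t ≠ t' ∧ |t - t'| ≤ Θ then f (t - t') else 0) +
          ∑ i ∈ S, (if (2 : ℝ) ^ i ≤ |t - t'| ∧ |t - t'| ≤ 2 * 2 ^ i then f (t - t') else 0)) :=
        Finset.sum_le_sum fun t ht ↦ Finset.sum_le_sum fun t' ht' ↦ hterm t ht t' ht'
    _ = W.card * f 0 + ∑ t ∈ W, ∑ t' ∈ W, (if t ≠ t' ∧ |t - t'| ≤ Θ then f (t - t') else 0) +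
        ∑ t ∈ W, ∑ t' ∈ W, ∑ i ∈ S,
          (if (2 : ℝ) ^ i ≤ |t - t'| ∧ |t - t'| ≤ 2 * 2 ^ i then f (t - t') else 0) := by
        simp only [Finset.sum_add_distrib]
        congr 1; congr 1
        rw [Finset.sum_congr rfl fun t ht ↦ Finset.sum_ite_eq W t (fun _ ↦ f 0)]
        simp only [Finset.sum_ite_mem, Finset.inter_self, Finset.sum_const, nsmul_eq_mul]
    _ = _ := by
        congr 1
        calc ∑ t ∈ W, ∑ t' ∈ W, ∑ i ∈ S,
              (if (2 : ℝ) ^ i ≤ |t - t'| ∧ |t - t'| ≤ 2 * 2 ^ i then f (t - t') else 0)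
            = ∑ t ∈ W, ∑ i ∈ S, ∑ t' ∈ W,
              (if (2 : ℝ) ^ i ≤ |t - t'| ∧ |t - t'| ≤ 2 * 2 ^ i then f (t - t') else 0) :=
              Finset.sum_congr rfl fun _ _ ↦ Finset.sum_comm
          _ = ∑ i ∈ S, ∑ t ∈ W, ∑ t' ∈ W,
              (if (2 : ℝ) ^ i ≤ |t - t'| ∧ |t - t'| ≤ 2 * 2 ^ i then f (t - t') else 0) := Finset.sum_comm

end weight

/-! ## §9. Proposition 6.1 with `k = 4` in the setting of Proposition 3.1 (`T = N^{6/5}`): the hypothesis `hS2` -/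

/-- A `1`-separated finite set in a window `[t₀, t₀ + T]` has at most `T + 1` elements. [folklore] -/
theorem card_le_of_window {W : Finset ℝ} {t₀ T : ℝ} (hT : 0 ≤ T)
    (hwin : ∀ t ∈ W, t₀ ≤ t ∧ t ≤ t₀ + T) (hsep : ∀ t ∈ W, ∀ t' ∈ W, t ≠ t' → 1 ≤ |t - t'|) :
    (W.card : ℝ) ≤ T + 1 := by
  classical
  set V : Finset ℝ := W.image (fun t ↦ t - t₀) with hV
  have hinj : Set.InjOn (fun t : ℝ ↦ t - t₀) (W : Set ℝ) := fun a _ b _ h ↦ by simpa using h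
  have hcard : V.card = W.card := Finset.card_image_of_injOn hinj
  have hVwin : ∀ v ∈ V, 0 ≤ v ∧ v ≤ T := by
    intro v hv
    rw [hV, Finset.mem_image] at hv
    obtain ⟨t, ht, rfl⟩ := hv
    have := hwin t ht
    constructor <;> linarith [this.1, this.2]
  have hVsep : ∀ v ∈ V, ∀ v' ∈ V, v ≠ v' → 1 ≤ |v - v'| := by
    intro v hv v' hv' hne
    rw [hV, Finset.mem_image] at hv hv'
    obtain ⟨t, ht, rfl⟩ := hv
    obtain ⟨t', ht', rfl⟩ := hv'
    have hne' : t ≠ t' := fun h ↦ hne (by rw [h])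
    have := hsep t ht t' ht' hne'
    rwa [show t - t₀ - (t' - t₀) = t - t' by ring]
  have h := GuthMaynardReduction.card_le_of_one_sep hT V hVwin hVsep
  rwa [hcard] at h

/-- `R ≤ R²` for a natural number `R` (as reals). [folklore] -/
theorem natCast_le_sq (R : ℕ) : (R : ℝ) ≤ (R : ℝ) ^ 2 := by
  rcases Nat.eq_zero_or_pos R with h | h
  · simp [h]
  · exact le_self_pow₀ (by exact_mod_cast h) two_ne_zero

/-- `(x log(2x))² ≤ 4x⁴` for `x ≥ 1`. [folklore] -/
theorem sq_mul_log_le {x : ℝ} (hx : 1 ≤ x) : (x * Real.log (2 * x)) ^ 2 ≤ 4 * x ^ 4 := by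
  have h1 : Real.log (2 * x) ≤ 2 * x := (Real.log_le_sub_one_of_pos (by linarith)).trans (by linarith)
  have h2 : x * Real.log (2 * x) ≤ 2 * x ^ 2 := by
    calc x * Real.log (2 * x) ≤ x * (2 * x) := mul_le_mul_of_nonneg_left h1 (by linarith)
      _ = 2 * x ^ 2 := by ring
  have h3 : 0 ≤ x * Real.log (2 * x) := mul_nonneg (by linarith) (Real.log_nonneg (by linarith))
  calc (x * Real.log (2 * x)) ^ 2 ≤ (2 * x ^ 2) ^ 2 := pow_le_pow_left₀ h3 h2 2
    _ = 4 * x ^ 4 := by ring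

section weight

variable {w : ℝ → ℝ}

set_option maxHeartbeats 2000000 in
/-- **One dyadic class `2^i ≤ |t−t'| ≤ 2^{i+1}` in the setting of Proposition 3.1** (`n = N`,
`T = N^{6/5}`, threshold `Θ = n^{1−η} < 2^{i+1}`, length `M = ⌈n^η 2^i/n⌉`): combining
`sum_sq_norm_coefB_le` (hypothesis `hCA`) with `sum_sq_norm_dirD_le` (hypothesis `hCΦ`) gives
`class_i ≤ C_A K² C_Φ T^η (3n^{2η−1}|W|² + 27n^{2η−2}T|W|^{7/4} + 3n^{2η−1}T^{1/8}|W|^{29/16}) + (negligible)`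
("If `|t₁ − t₂| ∼ MN`, then `∑_{m≠0} ĥ_{t₁−t₂}(mN)` can be approximated by a Dirichlet polynomial of
length `M`"). [cite: GuthMaynard2026, Section 6, proof of Proposition 6.1] -/
theorem class_le {n T η : ℝ} {j K Mmax : ℕ} {CA CΦ : ℝ} (hCA0 : 0 ≤ CA) (hCΦ0 : 0 ≤ CΦ)
    (hn1 : 1 ≤ n) (hT1 : 1 ≤ T) (hη0 : 0 < η) (hη1 : η ≤ 1 / 10) (hj : 12 ≤ j)
    (hΘ9 : 9 ≤ n ^ (1 - η)) (W : Finset ℝ) (hMmax : 9 * n ^ η * T / n ≤ (Mmax : ℝ))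
    (hK2 : ∀ M : ℕ, M ≤ Mmax → 2 * (M : ℝ) ≤ 2 ^ K)
    (hCA : ∀ (M K : ℕ), 1 ≤ M → 2 * (M : ℝ) ≤ 2 ^ K → ∀ (T₀ : ℝ), 1 ≤ T₀ → ∀ (Φ : ℝ),
      (∀ ξ : ℝ, ∑ t ∈ W, ∑ t' ∈ W, ‖dirD M (t - t' + 2 * π * ξ)‖ ^ 2 ≤ Φ) →
      ∑ t ∈ W, ∑ t' ∈ W,
          (if T₀ ≤ |t - t'| ∧ |t - t'| ≤ 2 * T₀ then ‖coefB w n (t - t')‖ ^ 2 else 0) ≤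
        CA * K ^ 2 * Φ / T₀ + CA * (W.card : ℝ) ^ 2 *
          (((M : ℝ) * Real.log (2 * M)) ^ 2 / T₀ ^ (2 * j) +
            (1 + 2 * T₀) ^ (2 * j) / (n ^ (2 * j) * (M : ℝ) ^ (2 * j - 4))))
    (hCΦ : ∀ (M : ℕ), 1 ≤ M → (M : ℝ) ≤ T → ∀ ξ : ℝ,
      ∑ t ∈ W, ∑ t' ∈ W, ‖dirD M (t - t' + 2 * π * ξ)‖ ^ 2 ≤
        CΦ * T ^ η * ((M : ℝ) * (W.card : ℝ) ^ 2 + (M : ℝ) ^ 2 * (W.card : ℝ) ^ (7 / 4 : ℝ) +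
          (M : ℝ) * T ^ (1 / 8 : ℝ) * (W.card : ℝ) ^ (29 / 16 : ℝ)))
    {i : ℕ} (hiΘ : n ^ (1 - η) < (2 : ℝ) ^ (i + 1)) (hiT : (2 : ℝ) ^ i ≤ 3 * T) :
    ∑ t ∈ W, ∑ t' ∈ W,
        (if (2 : ℝ) ^ i ≤ |t - t'| ∧ |t - t'| ≤ 2 * 2 ^ i then ‖coefB w n (t - t')‖ ^ 2 else 0) ≤
      CA * (K : ℝ) ^ 2 * (CΦ * T ^ η * (3 * n ^ (2 * η) * n ^ (-1 : ℝ) * (W.card : ℝ) ^ 2 +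
          27 * n ^ (2 * η) * n ^ (-2 : ℝ) * T * (W.card : ℝ) ^ (7 / 4 : ℝ) +
          3 * n ^ (2 * η) * n ^ (-1 : ℝ) * T ^ (1 / 8 : ℝ) * (W.card : ℝ) ^ (29 / 16 : ℝ))) +
      CA * (W.card : ℝ) ^ 2 * (324 * 2 ^ (2 * j - 4) * n ^ (-((1 - η) * (2 * (j : ℝ) - 4))) +
        6561 * 9 ^ j * T ^ 4 * n ^ (-(2 * η * j))) := by
  have hn0 : 0 < n := by linarith
  have hT0 : 0 < T := by linarith
  set R : ℝ := (W.card : ℝ) with hR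
  have hR0 : 0 ≤ R := Nat.cast_nonneg _
  set Θ : ℝ := n ^ (1 - η) with hΘ
  set T₀ : ℝ := 2 ^ i with hT₀
  have hT₀1 : 1 ≤ T₀ := one_le_pow₀ one_le_two
  have hT₀0 : 0 < T₀ := by linarith
  have hΘT₀ : Θ < 2 * T₀ := by rw [hT₀, ← pow_succ']; exact hiΘ
  have hnηpos : 0 < n ^ η := Real.rpow_pos_of_pos hn0 η
  have hnη : n ^ η ≤ n := by
    conv_rhs => rw [← Real.rpow_one n]
    exact Real.rpow_le_rpow_of_exponent_le hn1 (by linarith)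
  have en : n ^ η * Θ = n := by
    rw [hΘ, ← Real.rpow_add hn0]; ring_nf; exact Real.rpow_one n
  -- the length `M`
  set x : ℝ := n ^ η * T₀ / n with hx
  have hx0 : 1 / 2 < x := by
    rw [hx, lt_div_iff₀ hn0]
    calc 1 / 2 * n = 1 / 2 * (n ^ η * Θ) := by rw [en]
      _ < 1 / 2 * (n ^ η * (2 * T₀)) :=
          mul_lt_mul_of_pos_left (mul_lt_mul_of_pos_left hΘT₀ hnηpos) (by norm_num)
      _ = n ^ η * T₀ := by ring
  set M : ℕ := ⌈x⌉₊ with hM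
  have hM1 : 1 ≤ M := Nat.one_le_iff_ne_zero.mpr (Nat.pos_iff_ne_zero.mp (Nat.ceil_pos.mpr (by linarith)))
  have hMr1 : (1 : ℝ) ≤ M := by exact_mod_cast hM1
  have hM0 : (0 : ℝ) < M := by linarith
  have hxM : x ≤ M := Nat.le_ceil x
  have hMx : (M : ℝ) ≤ 3 * x := by
    have := Nat.ceil_lt_add_one (show 0 ≤ x by linarith); rw [hM]; linarith
  have hMT₀ : (M : ℝ) ≤ 3 * n ^ η * T₀ / n := by
    calc (M : ℝ) ≤ 3 * x := hMx
      _ = 3 * n ^ η * T₀ / n := by rw [hx]; ring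
  have hxT₀ : x ≤ T₀ := by
    rw [hx, div_le_iff₀ hn0]
    calc n ^ η * T₀ ≤ n * T₀ := mul_le_mul_of_nonneg_right hnη hT₀0.le
      _ = T₀ * n := mul_comm _ _
  have hM3T₀ : (M : ℝ) ≤ 3 * T₀ := hMx.trans (by linarith)
  have hx3 : x ≤ 3 * n ^ η * T / n := by
    rw [hx]
    refine div_le_div_of_nonneg_right ?_ hn0.le
    calc n ^ η * T₀ ≤ n ^ η * (3 * T) := mul_le_mul_of_nonneg_left hiT hnηpos.le
      _ = 3 * n ^ η * T := by ring
  have hM9 : (M : ℝ) ≤ 9 * n ^ η * T / n := by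
    calc (M : ℝ) ≤ 3 * x := hMx
      _ ≤ 3 * (3 * n ^ η * T / n) := by linarith [hx3]
      _ = 9 * n ^ η * T / n := by ring
  have hMMmax : M ≤ Mmax := by
    rw [hM]; refine Nat.ceil_le.mpr (hx3.trans (le_trans ?_ hMmax))
    refine div_le_div_of_nonneg_right ?_ hn0.le
    nlinarith [hnηpos, hT0]
  have hMK : 2 * (M : ℝ) ≤ 2 ^ K := hK2 M hMMmax
  have h9n : 9 * n ^ η ≤ n := by
    calc 9 * n ^ η ≤ Θ * n ^ η := mul_le_mul_of_nonneg_right hΘ9 hnηpos.le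
      _ = n := by rw [mul_comm, en]
  have hMT : (M : ℝ) ≤ T := by
    refine hM9.trans ?_
    rw [div_le_iff₀ hn0]
    calc 9 * n ^ η * T = (9 * n ^ η) * T := by ring
      _ ≤ n * T := mul_le_mul_of_nonneg_right h9n hT0.le
      _ = T * n := mul_comm _ _
  -- the double zeta sum bound `Φ` and the class bound
  set Φ : ℝ := CΦ * T ^ η * ((M : ℝ) * R ^ 2 + (M : ℝ) ^ 2 * R ^ (7 / 4 : ℝ) + (M : ℝ) * T ^ (1 / 8 : ℝ) * R ^ (29 / 16 : ℝ))
    with hΦ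
  have hΦW : ∀ ξ : ℝ, ∑ t ∈ W, ∑ t' ∈ W, ‖dirD M (t - t' + 2 * π * ξ)‖ ^ 2 ≤ Φ :=
    fun ξ ↦ hCΦ M hM1 hMT ξ
  have hcl := hCA M K hM1 hMK T₀ hT₀1 Φ hΦW
  refine hcl.trans (add_le_add ?_ ?_)
  · -- main part: `Φ/T₀`
    have e1 : n ^ η / n = n ^ η * n ^ (-1 : ℝ) := by rw [Real.rpow_neg_one, div_eq_mul_inv]
    have hMdiv : (M : ℝ) / T₀ ≤ 3 * n ^ (2 * η) * n ^ (-1 : ℝ) := by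
      have h1 : (M : ℝ) / T₀ ≤ 3 * (n ^ η / n) := by
        rw [div_le_iff₀ hT₀0]; refine hMT₀.trans (le_of_eq ?_); field_simp
      have h2 : n ^ η ≤ n ^ (2 * η) := Real.rpow_le_rpow_of_exponent_le hn1 (by linarith)
      have h3 : n ^ η / n ≤ n ^ (2 * η) * n ^ (-1 : ℝ) := by
        rw [e1]; exact mul_le_mul_of_nonneg_right h2 (by positivity)
      linarith
    have hM2div : (M : ℝ) ^ 2 / T₀ ≤ 27 * n ^ (2 * η) * n ^ (-2 : ℝ) * T := by
      have h1 : (M : ℝ) ^ 2 / T₀ = (M : ℝ) * ((M : ℝ) / T₀) := by ring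
      have h2 : (M : ℝ) / T₀ ≤ 3 * (n ^ η / n) := by
        rw [div_le_iff₀ hT₀0]; refine hMT₀.trans (le_of_eq ?_); field_simp
      have h3 : (9 * n ^ η * T / n) * (3 * (n ^ η / n)) = 27 * n ^ (2 * η) * n ^ (-2 : ℝ) * T := by
        rw [show n ^ (2 * η) = n ^ η * n ^ η by rw [← Real.rpow_add hn0]; ring_nf,
          show n ^ (-2 : ℝ) = (n ^ 2)⁻¹ by rw [Real.rpow_neg hn0.le, Real.rpow_two]]
        field_simp
        norm_num
      rw [h1, ← h3]
      exact mul_le_mul hM9 h2 (by positivity) (by positivity)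
    have hΦT₀ : Φ / T₀ ≤ CΦ * T ^ η * (3 * n ^ (2 * η) * n ^ (-1 : ℝ) * R ^ 2 +
        27 * n ^ (2 * η) * n ^ (-2 : ℝ) * T * R ^ (7 / 4 : ℝ) +
        3 * n ^ (2 * η) * n ^ (-1 : ℝ) * T ^ (1 / 8 : ℝ) * R ^ (29 / 16 : ℝ)) := by
      have e : Φ / T₀ = CΦ * T ^ η * (((M : ℝ) / T₀) * R ^ 2 + ((M : ℝ) ^ 2 / T₀) * R ^ (7 / 4 : ℝ) +
          ((M : ℝ) / T₀) * (T ^ (1 / 8 : ℝ) * R ^ (29 / 16 : ℝ))) := by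
        rw [hΦ]; field_simp
      rw [e]
      refine mul_le_mul_of_nonneg_left ?_ (by positivity)
      have a1 : ((M : ℝ) / T₀) * R ^ 2 ≤ (3 * n ^ (2 * η) * n ^ (-1 : ℝ)) * R ^ 2 :=
        mul_le_mul_of_nonneg_right hMdiv (by positivity)
      have a2 : ((M : ℝ) ^ 2 / T₀) * R ^ (7 / 4 : ℝ) ≤ (27 * n ^ (2 * η) * n ^ (-2 : ℝ) * T) * R ^ (7 / 4 : ℝ) :=
        mul_le_mul_of_nonneg_right hM2div (by positivity)
      have a3 : ((M : ℝ) / T₀) * (T ^ (1 / 8 : ℝ) * R ^ (29 / 16 : ℝ)) ≤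
          (3 * n ^ (2 * η) * n ^ (-1 : ℝ)) * (T ^ (1 / 8 : ℝ) * R ^ (29 / 16 : ℝ)) :=
        mul_le_mul_of_nonneg_right hMdiv (by positivity)
      linarith
    calc CA * (K : ℝ) ^ 2 * Φ / T₀ = CA * (K : ℝ) ^ 2 * (Φ / T₀) := by ring
      _ ≤ _ := mul_le_mul_of_nonneg_left hΦT₀ (by positivity)
  · -- negligible part
    refine mul_le_mul_of_nonneg_left (add_le_add ?_ ?_) (by positivity)
    · -- (a) `(M log 2M)² / T₀^{2j} ≤ 324 T₀⁴/T₀^{2j} ≤ 324 (2/Θ)^{2j-4}`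
      have h1 : ((M : ℝ) * Real.log (2 * M)) ^ 2 ≤ 4 * (M : ℝ) ^ 4 := sq_mul_log_le hMr1
      have h2 : (M : ℝ) ^ 4 ≤ 81 * T₀ ^ 4 := by
        calc (M : ℝ) ^ 4 ≤ (3 * T₀) ^ 4 := pow_le_pow_left₀ hM0.le hM3T₀ 4
          _ = 81 * T₀ ^ 4 := by ring
      have h3 : ((M : ℝ) * Real.log (2 * M)) ^ 2 / T₀ ^ (2 * j) ≤ 324 * T₀ ^ 4 / T₀ ^ (2 * j) :=
        div_le_div_of_nonneg_right (by linarith) (by positivity)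
      refine h3.trans ?_
      have e : (324 : ℝ) * T₀ ^ 4 / T₀ ^ (2 * j) = 324 * (T₀ ^ (2 * j - 4))⁻¹ := by
        have : T₀ ^ (2 * j) = T₀ ^ 4 * T₀ ^ (2 * j - 4) := by rw [← pow_add]; congr 1; omega
        rw [this]; field_simp
      rw [e, mul_assoc]
      refine mul_le_mul_of_nonneg_left ?_ (by norm_num)
      have hΘ0 : 0 < Θ := by linarith
      have hΘ2 : Θ / 2 ≤ T₀ := by linarith
      have h4 : (Θ / 2) ^ (2 * j - 4) ≤ T₀ ^ (2 * j - 4) := pow_le_pow_left₀ (by positivity) hΘ2 _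
      have h5 : (T₀ ^ (2 * j - 4))⁻¹ ≤ ((Θ / 2) ^ (2 * j - 4))⁻¹ := inv_anti₀ (by positivity) h4
      refine h5.trans (le_of_eq ?_)
      have h6 : ((2 * j - 4 : ℕ) : ℝ) = 2 * (j : ℝ) - 4 := by
        rw [Nat.cast_sub (by omega)]; push_cast; ring
      rw [div_pow, inv_div, hΘ, ← Real.rpow_natCast (n ^ (1 - η)) (2 * j - 4), ← Real.rpow_mul hn0.le,
        Real.rpow_neg hn0.le, div_eq_mul_inv, h6]
    · -- (b) `(1+2T₀)^{2j}/(n^{2j} M^{2j-4}) = M⁴ ((1+2T₀)/(nM))^{2j} ≤ 6561 T⁴ (3 n^{-η})^{2j}`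
      have hnM : n ^ η * T₀ ≤ n * M := by
        calc n ^ η * T₀ = x * n := by rw [hx]; field_simp
          _ ≤ (M : ℝ) * n := mul_le_mul_of_nonneg_right hxM hn0.le
          _ = n * M := mul_comm _ _
      have hratio : (1 + 2 * T₀) / (n * M) ≤ 3 * n ^ (-η) := by
        rw [div_le_iff₀ (by positivity)]
        have e : 3 * n ^ (-η) * (n ^ η * T₀) = 3 * T₀ := by
          rw [Real.rpow_neg hn0.le]; field_simp
        calc 1 + 2 * T₀ ≤ 3 * T₀ := by linarith
          _ = 3 * n ^ (-η) * (n ^ η * T₀) := e.symm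
          _ ≤ 3 * n ^ (-η) * (n * M) := mul_le_mul_of_nonneg_left hnM (by positivity)
      have e1 : (1 + 2 * T₀) ^ (2 * j) / (n ^ (2 * j) * (M : ℝ) ^ (2 * j - 4)) =
          (M : ℝ) ^ 4 * ((1 + 2 * T₀) / (n * M)) ^ (2 * j) := by
        rw [div_pow, mul_pow]
        have : (M : ℝ) ^ (2 * j) = (M : ℝ) ^ 4 * (M : ℝ) ^ (2 * j - 4) := by rw [← pow_add]; congr 1; omega
        rw [this]; field_simp
      rw [e1]
      have h2 : ((1 + 2 * T₀) / (n * M)) ^ (2 * j) ≤ (3 * n ^ (-η)) ^ (2 * j) :=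
        pow_le_pow_left₀ (by positivity) hratio _
      have h3 : (M : ℝ) ^ 4 ≤ 6561 * T ^ 4 := by
        calc (M : ℝ) ^ 4 ≤ (3 * T₀) ^ 4 := pow_le_pow_left₀ hM0.le hM3T₀ 4
          _ ≤ (9 * T) ^ 4 := pow_le_pow_left₀ (by positivity) (by linarith) 4
          _ = 6561 * T ^ 4 := by ring
      have e2 : (3 * n ^ (-η)) ^ (2 * j) = 9 ^ j * n ^ (-(2 * η * j)) := by
        rw [mul_pow, ← Real.rpow_natCast (n ^ (-η)) (2 * j), ← Real.rpow_mul hn0.le, pow_mul]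
        congr 1
        · norm_num
        · congr 1; push_cast; ring
      calc (M : ℝ) ^ 4 * ((1 + 2 * T₀) / (n * M)) ^ (2 * j) ≤ (6561 * T ^ 4) * (3 * n ^ (-η)) ^ (2 * j) :=
          mul_le_mul h3 h2 (by positivity) (by positivity)
        _ = 6561 * 9 ^ j * T ^ 4 * n ^ (-(2 * η * j)) := by rw [e2]; ring

end weight

section weight

variable {w : ℝ → ℝ}

set_option maxHeartbeats 4000000 in
/-- **Guth–Maynard Proposition 6.1 (`S₂` bound) with `k = 4`, in the setting of Proposition 3.1**
(`W` in an interval of length `T = N^{6/5}`, `T^ε`-separated): for every smooth `w` supported in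
`[1,2]` and every `ε, δ > 0` there are `C, N₀` with
`|S₂| ≤ C N^δ (N²|W|² + TN|W|^{7/4} + N²T^{1/8}|W|^{29/16})` for `N ≥ N₀`
— the hypothesis `hS2` of `GuthMaynardAssembly.zeroDensity_guth_maynard_of_bounds`, proved:
`norm_S2_le` (reduction to `∑|B_N(t−t')|²`), `sum_pairs_le_classes` (diagonal, small differences
`|t−t'| ≤ N^{1−η}` where `B_N` is negligible by Lemma 4.3, and dyadic classes), `class_le`
(Lemma 6.2 and Cauchy–Schwarz via `sum_sq_norm_coefB_le` with `M ≍ N^ηT₀/N`, then Hölder with `k = 4`,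
the divisor bound and Heath-Brown's theorem via `sum_sq_norm_dirD_le`).
[cite: GuthMaynard2026, Proposition 6.1] -/
theorem S2_bound (hw : ContDiff ℝ ∞ w) (hsupp : Function.support w ⊆ Set.Icc 1 2)
    {ε : ℝ} (hε : 0 < ε) {δ : ℝ} (hδ : 0 < δ) : ∃ C N₀ : ℝ, ∀ N : ℕ, N₀ ≤ (N : ℝ) →
      ∀ (t₀ : ℝ) (W : Finset ℝ), (∀ t ∈ W, t₀ ≤ t ∧ t ≤ t₀ + (N : ℝ) ^ (6 / 5 : ℝ)) →
      (∀ t ∈ W, ∀ t' ∈ W, t ≠ t' → ((N : ℝ) ^ (6 / 5 : ℝ)) ^ ε ≤ |t - t'|) →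
      ‖S2 w N W‖ ≤ C * (N : ℝ) ^ δ * ((N : ℝ) ^ 2 * (W.card : ℝ) ^ 2 +
        (N : ℝ) ^ (6 / 5 : ℝ) * N * (W.card : ℝ) ^ (7 / 4 : ℝ) +
        (N : ℝ) ^ 2 * ((N : ℝ) ^ (6 / 5 : ℝ)) ^ (1 / 8 : ℝ) * (W.card : ℝ) ^ (29 / 16 : ℝ)) := by
  classical
  -- parameters
  set δ₁ : ℝ := min δ 1 with hδ₁
  have hδ₁0 : 0 < δ₁ := lt_min hδ one_pos
  have hδ₁1 : δ₁ ≤ 1 := min_le_right _ _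
  have hδ₁δ : δ₁ ≤ δ := min_le_left _ _
  set η : ℝ := δ₁ / 10 with hη
  have hη0 : 0 < η := by positivity
  have hη1 : η ≤ 1 / 10 := by rw [hη]; linarith
  set j : ℕ := 12 + ⌈4 / η⌉₊ + ⌈6 / ε⌉₊ with hj
  have hj12 : 12 ≤ j := by omega
  have hj2 : 2 ≤ j := by omega
  have hjr : (12 : ℝ) ≤ j := by exact_mod_cast hj12
  have hηj : 4 ≤ η * j := by
    have h1 : (4 / η : ℝ) ≤ ⌈4 / η⌉₊ := Nat.le_ceil _
    have h2 : ((⌈4 / η⌉₊ : ℕ) : ℝ) ≤ j := by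
      rw [hj]; push_cast; linarith [Nat.cast_nonneg (α := ℝ) ⌈6 / ε⌉₊]
    calc (4 : ℝ) = η * (4 / η) := by field_simp
      _ ≤ η * j := mul_le_mul_of_nonneg_left (h1.trans h2) hη0.le
  have hεj : 6 ≤ ε * j := by
    have h1 : (6 / ε : ℝ) ≤ ⌈6 / ε⌉₊ := Nat.le_ceil _
    have h2 : ((⌈6 / ε⌉₊ : ℕ) : ℝ) ≤ j := by
      rw [hj]; push_cast; linarith [Nat.cast_nonneg (α := ℝ) ⌈4 / η⌉₊]
    calc (6 : ℝ) = ε * (6 / ε) := by field_simp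
      _ ≤ ε * j := mul_le_mul_of_nonneg_left (h1.trans h2) hε.le
  have hηj2 : 8 ≤ 2 * η * (j : ℝ) := by linarith [show 2 * η * (j : ℝ) = 2 * (η * j) by ring]
  -- constants from the lemmas
  obtain ⟨CS, hCS0, hCS⟩ := norm_S2_le hw hsupp j
  obtain ⟨CB, hCB0, hCB⟩ := norm_coefB_le hw hsupp hj2
  obtain ⟨CA, hCA0, hCA⟩ := sum_sq_norm_coefB_le hw hsupp hj2
  obtain ⟨CΦ, TΦ, hCΦ0, hCΦ⟩ := sum_sq_norm_dirD_le hη0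
  set Cη : ℝ := 1 / (η * Real.log 2) + 1 with hCη
  have hCη0 : 0 ≤ Cη := by positivity
  set cI : ℝ := Cη * 2 ^ η + 1 with hcI
  set cK : ℝ := Cη * 10 ^ η + 1 with hcK
  have hcI0 : 0 ≤ cI := by positivity
  have hcK0 : 0 ≤ cK := by positivity
  -- the constant and the threshold
  set c₁ : ℝ := CS * CB ^ 2 with hc₁
  set c₂ : ℝ := CS * CB ^ 2 * 4 ^ j with hc₂
  set c₃ : ℝ := CS * cI * (27 * (CA * CΦ * cK ^ 2)) with hc₃
  set c₄ : ℝ := CS * cI * (CA * (324 * 2 ^ (2 * j - 4) + 6561 * 9 ^ j)) with hc₄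
  set c₅ : ℝ := CS * 32 with hc₅
  refine ⟨c₁ + c₂ + c₃ + c₄ + c₅, max (max TΦ 81) 2, fun N hN t₀ W hwin hsep ↦ ?_⟩
  -- basic quantities
  set n : ℝ := (N : ℝ) with hn
  have hnT : TΦ ≤ n := le_trans ((le_max_left _ _).trans (le_max_left _ _)) hN
  have hn81 : (81 : ℝ) ≤ n := le_trans ((le_max_right _ _).trans (le_max_left _ _)) hN
  have hn2 : (2 : ℝ) ≤ n := le_trans (le_max_right _ _) hN
  have hn1 : (1 : ℝ) ≤ n := by linarith
  have hn0 : (0 : ℝ) < n := by linarith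
  have hNnat : 1 ≤ N := by rw [hn] at hn1; exact_mod_cast hn1
  set T : ℝ := n ^ (6 / 5 : ℝ) with hT
  have hTn : n ≤ T := by
    rw [hT]; conv_lhs => rw [← Real.rpow_one n]
    exact Real.rpow_le_rpow_of_exponent_le hn1 (by norm_num)
  have hT1 : 1 ≤ T := hn1.trans hTn
  have hT2 : 2 ≤ T := hn2.trans hTn
  have hT0 : 0 < T := by linarith
  have hTΦ : TΦ ≤ T := hnT.trans hTn
  set s : ℝ := T ^ ε with hs
  have hs1 : 1 ≤ s := Real.one_le_rpow hT1 hε.le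
  have hs0 : 0 < s := by linarith
  have hsep1 : ∀ t ∈ W, ∀ t' ∈ W, t ≠ t' → 1 ≤ |t - t'| := fun t ht t' ht' hne ↦
    hs1.trans (hsep t ht t' ht' hne)
  have hdiam : ∀ t ∈ W, ∀ t' ∈ W, |t - t'| ≤ T := by
    intro t ht t' ht'
    have h1 := hwin t ht; have h2 := hwin t' ht'
    rw [abs_le]; constructor <;> linarith [h1.1, h1.2, h2.1, h2.2]
  -- Step 1: `S₂` in terms of `P = ∑ |B|²`
  have hS := hCS N hNnat W s T hs0 hT0.le (fun t ht t' ht' hne ↦ hsep t ht t' ht' hne) hdiam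
  rw [← hn] at hS
  set R : ℝ := (W.card : ℝ) with hR
  have hR0 : 0 ≤ R := Nat.cast_nonneg _
  have hRT : R ≤ T + 1 := card_le_of_window hT0.le hwin hsep1
  have hRT2 : R ≤ 2 * T := by linarith
  set P : ℝ := ∑ t ∈ W, ∑ t' ∈ W, ‖coefB w n (t - t')‖ ^ 2 with hP
  have hP0 : 0 ≤ P := Finset.sum_nonneg fun _ _ ↦ Finset.sum_nonneg fun _ _ ↦ by positivity
  -- the target pieces
  set X₁ : ℝ := n ^ 2 * R ^ 2 with hX₁
  set X₂ : ℝ := T * n * R ^ (7 / 4 : ℝ) with hX₂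
  set X₃ : ℝ := n ^ 2 * T ^ (1 / 8 : ℝ) * R ^ (29 / 16 : ℝ) with hX₃
  have hX₁0 : 0 ≤ X₁ := by positivity
  have hX₂0 : 0 ≤ X₂ := by positivity
  have hX₃0 : 0 ≤ X₃ := by positivity
  set Main : ℝ := X₁ + X₂ + X₃ with hMain
  have hMain0 : 0 ≤ Main := by positivity
  have hnδ : 1 ≤ n ^ δ := Real.one_le_rpow hn1 hδ.le
  set Z : ℝ := n ^ δ * Main with hZ
  have hZ0 : 0 ≤ Z := by positivity
  have hX₁Z : X₁ ≤ Z := by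
    calc X₁ ≤ Main := by rw [hMain]; linarith
      _ ≤ n ^ δ * Main := le_mul_of_one_le_left hMain0 hnδ
  have hMainZ : Main ≤ Z := le_mul_of_one_le_left hMain0 hnδ
  -- Step 2: decomposition of the pairs
  set Θ : ℝ := n ^ (1 - η) with hΘ
  have hΘ1 : 1 ≤ Θ := Real.one_le_rpow hn1 (by linarith)
  have hΘ9 : 9 ≤ Θ := by
    have h1 : (81 : ℝ) ^ (1 / 2 : ℝ) = 9 := by
      rw [show (81 : ℝ) = 9 ^ 2 by norm_num, pow_rpow_eq (by norm_num)]; norm_num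
    calc (9 : ℝ) = 81 ^ (1 / 2 : ℝ) := h1.symm
      _ ≤ n ^ (1 / 2 : ℝ) := Real.rpow_le_rpow (by norm_num) hn81 (by norm_num)
      _ ≤ n ^ (1 - η) := Real.rpow_le_rpow_of_exponent_le hn1 (by linarith)
  set I : ℕ := Nat.log 2 ⌈T⌉₊ + 1 with hI
  have hTceil : 1 ≤ ⌈T⌉₊ := Nat.one_le_iff_ne_zero.mpr (Nat.pos_iff_ne_zero.mp (Nat.ceil_pos.mpr hT0))
  have hTI : T ≤ 2 ^ I := by
    have h1 : (⌈T⌉₊ : ℝ) < 2 ^ (Nat.log 2 ⌈T⌉₊ + 1) := by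
      exact_mod_cast Nat.lt_pow_succ_log_self one_lt_two ⌈T⌉₊
    exact (Nat.le_ceil T).trans h1.le
  have hclasses := sum_pairs_le_classes (fun τ ↦ ‖coefB w n τ‖ ^ 2) (fun _ ↦ by positivity) W hΘ1 hTI hdiam
  set Igood := (Finset.range (I + 1)).filter (fun i ↦ Θ < (2 : ℝ) ^ (i + 1)) with hIgood
  -- the number of classes
  have hIcard : (Igood.card : ℝ) ≤ cI * T ^ η := by
    have h1 : (Igood.card : ℝ) ≤ I + 1 := by
      have : Igood.card ≤ (Finset.range (I + 1)).card := Finset.card_filter_le _ _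
      rw [Finset.card_range] at this
      exact_mod_cast this
    have h2 : ((Nat.log 2 ⌈T⌉₊ : ℕ) : ℝ) + 1 ≤ Cη * (⌈T⌉₊ : ℝ) ^ η := natLog_add_one_le hη0 hTceil
    have h3 : (⌈T⌉₊ : ℝ) ≤ 2 * T := by linarith [Nat.ceil_lt_add_one hT0.le]
    have h4 : (⌈T⌉₊ : ℝ) ^ η ≤ 2 ^ η * T ^ η := by
      rw [← Real.mul_rpow zero_le_two hT0.le]; exact Real.rpow_le_rpow (Nat.cast_nonneg _) h3 hη0.le
    have h5 : (1 : ℝ) ≤ T ^ η := Real.one_le_rpow hT1 hη0.le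
    calc (Igood.card : ℝ) ≤ I + 1 := h1
      _ = (((Nat.log 2 ⌈T⌉₊ : ℕ) : ℝ) + 1) + 1 := by rw [hI]; push_cast; ring
      _ ≤ Cη * (2 ^ η * T ^ η) + T ^ η := add_le_add (h2.trans (mul_le_mul_of_nonneg_left h4 hCη0)) h5
      _ = cI * T ^ η := by rw [hcI]; ring
  -- Step 3: the diagonal and the small differences
  have hB0 : ‖coefB w n 0‖ ^ 2 ≤ CB ^ 2 * n ^ (-(2 * (j : ℝ))) := by
    have h := hCB 0 n hn1
    simp only [abs_zero, add_zero, one_pow, mul_one] at h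
    have h' : ‖coefB w n 0‖ ≤ CB * n ^ (-(j : ℝ)) := by
      rw [Real.rpow_neg hn0.le, Real.rpow_natCast, ← div_eq_mul_inv]; exact h
    calc ‖coefB w n 0‖ ^ 2 ≤ (CB * n ^ (-(j : ℝ))) ^ 2 := pow_le_pow_left₀ (norm_nonneg _) h' 2
      _ = CB ^ 2 * n ^ (-(2 * (j : ℝ))) := by
          rw [mul_pow, ← Real.rpow_natCast (n ^ (-(j : ℝ))) 2, ← Real.rpow_mul hn0.le]; push_cast; ring_nf
  have hsmall : ∀ t ∈ W, ∀ t' ∈ W, (if t ≠ t' ∧ |t - t'| ≤ Θ then ‖coefB w n (t - t')‖ ^ 2 else 0) ≤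
      CB ^ 2 * 4 ^ j * n ^ (-(2 * η * j)) := by
    intro t _ t' _
    split_ifs with h
    · have h1 := hCB (t - t') n hn1
      have h2 : (1 + |t - t'|) ^ j ≤ (2 * Θ) ^ j := pow_le_pow_left₀ (by positivity) (by linarith [h.2]) j
      have e3 : (2 * Θ) ^ j = 2 ^ j * n ^ (-(η * j)) * n ^ j := by
        rw [mul_pow, hΘ, ← Real.rpow_natCast (n ^ (1 - η)) j, ← Real.rpow_mul hn0.le,
          ← Real.rpow_natCast n j, mul_assoc, ← Real.rpow_add hn0]
        congr 2; ring
      have h3 : ‖coefB w n (t - t')‖ ≤ CB * 2 ^ j * n ^ (-(η * j)) := by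
        refine h1.trans ?_
        rw [div_le_iff₀ (by positivity)]
        calc CB * (1 + |t - t'|) ^ j ≤ CB * (2 * Θ) ^ j := mul_le_mul_of_nonneg_left h2 hCB0
          _ = CB * 2 ^ j * n ^ (-(η * j)) * n ^ j := by rw [e3]; ring
      have e4 : (CB * 2 ^ j * n ^ (-(η * j))) ^ 2 = CB ^ 2 * 4 ^ j * n ^ (-(2 * η * j)) := by
        rw [mul_pow, mul_pow, ← pow_mul, ← Real.rpow_natCast (n ^ (-(η * j))) 2, ← Real.rpow_mul hn0.le,
          show (2 : ℝ) ^ (j * 2) = 4 ^ j by rw [mul_comm, pow_mul]; norm_num]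
        congr 1; push_cast; ring
      calc ‖coefB w n (t - t')‖ ^ 2 ≤ (CB * 2 ^ j * n ^ (-(η * j))) ^ 2 := pow_le_pow_left₀ (norm_nonneg _) h3 2
        _ = CB ^ 2 * 4 ^ j * n ^ (-(2 * η * j)) := e4
    · positivity
  have hPsmall : ∑ t ∈ W, ∑ t' ∈ W, (if t ≠ t' ∧ |t - t'| ≤ Θ then ‖coefB w n (t - t')‖ ^ 2 else 0) ≤
      R ^ 2 * (CB ^ 2 * 4 ^ j * n ^ (-(2 * η * j))) := by
    calc ∑ t ∈ W, ∑ t' ∈ W, (if t ≠ t' ∧ |t - t'| ≤ Θ then ‖coefB w n (t - t')‖ ^ 2 else 0)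
        ≤ ∑ t ∈ W, ∑ t' ∈ W, CB ^ 2 * 4 ^ j * n ^ (-(2 * η * j)) :=
          Finset.sum_le_sum fun t ht ↦ Finset.sum_le_sum fun t' ht' ↦ hsmall t ht t' ht'
      _ = R ^ 2 * (CB ^ 2 * 4 ^ j * n ^ (-(2 * η * j))) := by
          simp only [Finset.sum_const, nsmul_eq_mul, hR]; ring
  -- Step 4: the dyadic classes
  set Mmax : ℕ := ⌈9 * n ^ η * T / n⌉₊ with hMmax
  set K : ℕ := Nat.log 2 Mmax + 2 with hK
  have hnηpos : 0 < n ^ η := Real.rpow_pos_of_pos hn0 η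
  have hnη : n ^ η ≤ n := by
    conv_rhs => rw [← Real.rpow_one n]
    exact Real.rpow_le_rpow_of_exponent_le hn1 (by linarith)
  have hMmax1 : 1 ≤ Mmax := by
    rw [hMmax]; refine Nat.one_le_iff_ne_zero.mpr (Nat.pos_iff_ne_zero.mp (Nat.ceil_pos.mpr ?_))
    have h9 : 9 * n ^ η * T / n = 9 * n ^ η * (T / n) := by ring
    rw [h9]; exact mul_pos (by positivity) (div_pos hT0 hn0)
  have hMmaxle : 9 * n ^ η * T / n ≤ (Mmax : ℝ) := Nat.le_ceil _
  have hK2 : ∀ M : ℕ, M ≤ Mmax → 2 * (M : ℝ) ≤ 2 ^ K := by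
    intro M hM
    have h1 : (Mmax : ℝ) < 2 ^ (Nat.log 2 Mmax + 1) := by exact_mod_cast Nat.lt_pow_succ_log_self one_lt_two Mmax
    have h2 : (M : ℝ) ≤ Mmax := by exact_mod_cast hM
    rw [hK, show Nat.log 2 Mmax + 2 = (Nat.log 2 Mmax + 1) + 1 by ring, pow_succ]
    linarith
  have hKbound : (K : ℝ) ≤ cK * T ^ η := by
    have h2 : ((Nat.log 2 Mmax : ℕ) : ℝ) + 1 ≤ Cη * (Mmax : ℝ) ^ η := natLog_add_one_le hη0 hMmax1
    have h3 : (Mmax : ℝ) ≤ 10 * T := by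
      have h4 : 9 * n ^ η * T / n ≤ 9 * T := by
        rw [div_le_iff₀ hn0]
        calc 9 * n ^ η * T = 9 * (n ^ η * T) := by ring
          _ ≤ 9 * (n * T) := by gcongr
          _ = 9 * T * n := by ring
      have := Nat.ceil_lt_add_one (show (0 : ℝ) ≤ 9 * n ^ η * T / n by positivity)
      rw [hMmax]; linarith
    have h4 : (Mmax : ℝ) ^ η ≤ 10 ^ η * T ^ η := by
      rw [← Real.mul_rpow (by norm_num) hT0.le]; exact Real.rpow_le_rpow (Nat.cast_nonneg _) h3 hη0.le
    have h5 : (1 : ℝ) ≤ T ^ η := Real.one_le_rpow hT1 hη0.le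
    calc (K : ℝ) = (((Nat.log 2 Mmax : ℕ) : ℝ) + 1) + 1 := by rw [hK]; push_cast; ring
      _ ≤ Cη * (10 ^ η * T ^ η) + T ^ η := add_le_add (h2.trans (mul_le_mul_of_nonneg_left h4 hCη0)) h5
      _ = cK * T ^ η := by rw [hcK]; ring
  -- uniform bound for each good class (from `class_le`)
  set MainC : ℝ := CA * (K : ℝ) ^ 2 * (CΦ * T ^ η * (3 * n ^ (2 * η) * n ^ (-1 : ℝ) * R ^ 2 +
      27 * n ^ (2 * η) * n ^ (-2 : ℝ) * T * R ^ (7 / 4 : ℝ) +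
      3 * n ^ (2 * η) * n ^ (-1 : ℝ) * T ^ (1 / 8 : ℝ) * R ^ (29 / 16 : ℝ))) with hMainC
  set NeglC : ℝ := CA * R ^ 2 * (324 * 2 ^ (2 * j - 4) * n ^ (-((1 - η) * (2 * (j : ℝ) - 4))) +
    6561 * 9 ^ j * T ^ 4 * n ^ (-(2 * η * j))) with hNeglC
  have hMainC0 : 0 ≤ MainC := by positivity
  have hNeglC0 : 0 ≤ NeglC := by positivity
  have hclass : ∀ i ∈ Igood, ∑ t ∈ W, ∑ t' ∈ W,
      (if (2 : ℝ) ^ i ≤ |t - t'| ∧ |t - t'| ≤ 2 * 2 ^ i then ‖coefB w n (t - t')‖ ^ 2 else 0) ≤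
        MainC + NeglC := by
    intro i hi
    rw [hIgood, Finset.mem_filter, Finset.mem_range] at hi
    obtain ⟨hiI, hiΘ⟩ := hi
    have hiT : (2 : ℝ) ^ i ≤ 3 * T := by
      have h1 : (2 : ℝ) ^ i ≤ 2 ^ I := pow_le_pow_right₀ one_le_two (Nat.lt_succ_iff.mp hiI)
      have h2 : (2 : ℝ) ^ I ≤ 2 * ⌈T⌉₊ := by
        rw [hI, pow_succ']
        have : ((2 ^ Nat.log 2 ⌈T⌉₊ : ℕ) : ℝ) ≤ ⌈T⌉₊ := by
          exact_mod_cast Nat.pow_log_le_self 2 (by omega)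
        push_cast at this; linarith
      have h3 : (⌈T⌉₊ : ℝ) ≤ T + 1 := (Nat.ceil_lt_add_one hT0.le).le
      linarith
    exact class_le hCA0 hCΦ0 hn1 hT1 hη0 hη1 hj12 hΘ9 W hMmaxle hK2
      (fun M K hM hMK T₀ hT₀ Φ hΦ ↦ hCA n hn1 M K hM hMK T₀ hT₀ W Φ hΦ)
      (fun M hM hMT ξ ↦ hCΦ T hTΦ M hM hMT W t₀ hwin hsep1 ξ) hiΘ hiT
  have hPclasses : ∑ i ∈ Igood, ∑ t ∈ W, ∑ t' ∈ W,
      (if (2 : ℝ) ^ i ≤ |t - t'| ∧ |t - t'| ≤ 2 * 2 ^ i then ‖coefB w n (t - t')‖ ^ 2 else 0) ≤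
        cI * T ^ η * (MainC + NeglC) := by
    calc _ ≤ ∑ i ∈ Igood, (MainC + NeglC) := Finset.sum_le_sum hclass
      _ = Igood.card * (MainC + NeglC) := by rw [Finset.sum_const, nsmul_eq_mul]
      _ ≤ cI * T ^ η * (MainC + NeglC) := mul_le_mul_of_nonneg_right hIcard (by positivity)
  -- Step 5: collect
  have hPle : P ≤ R * (CB ^ 2 * n ^ (-(2 * (j : ℝ)))) + R ^ 2 * (CB ^ 2 * 4 ^ j * n ^ (-(2 * η * j))) +
      cI * T ^ η * (MainC + NeglC) := by
    refine hclasses.trans ?_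
    have h1 : (W.card : ℝ) * ‖coefB w n 0‖ ^ 2 ≤ R * (CB ^ 2 * n ^ (-(2 * (j : ℝ)))) :=
      mul_le_mul_of_nonneg_left hB0 hR0
    linarith [h1, hPsmall, hPclasses]
  -- convert `T` powers to `n` powers
  have hTpow : ∀ a : ℝ, T ^ a = n ^ (6 / 5 * a) := fun a ↦ by rw [hT, ← Real.rpow_mul hn0.le]
  have hn3 : n ^ (3 : ℕ) = n ^ (3 : ℝ) := by rw [← Real.rpow_natCast]; norm_num
  have hn2' : n ^ (2 : ℕ) = n ^ (2 : ℝ) := by rw [← Real.rpow_natCast]; norm_num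
  -- (P1) diagonal
  have hP1 : CS * n ^ 3 * (R * (CB ^ 2 * n ^ (-(2 * (j : ℝ))))) ≤ c₁ * Z := by
    have h1 : n ^ (3 : ℝ) * n ^ (-(2 * (j : ℝ))) ≤ n ^ (2 : ℝ) := by
      rw [← Real.rpow_add hn0]; exact Real.rpow_le_rpow_of_exponent_le hn1 (by linarith)
    have h2 : n ^ (3 : ℝ) * n ^ (-(2 * (j : ℝ))) * R ≤ n ^ (2 : ℝ) * R ^ 2 :=
      mul_le_mul h1 (natCast_le_sq _) hR0 (Real.rpow_nonneg hn0.le 2)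
    have h3 : n ^ (2 : ℝ) * R ^ 2 ≤ Z := by rw [← hn2']; exact hX₁Z
    calc CS * n ^ 3 * (R * (CB ^ 2 * n ^ (-(2 * (j : ℝ))))) = c₁ * (n ^ (3 : ℝ) * n ^ (-(2 * (j : ℝ))) * R) := by
          rw [hn3, hc₁]; ring
      _ ≤ c₁ * Z := mul_le_mul_of_nonneg_left (h2.trans h3) (by positivity)
  -- (P2) small differences
  have hP2 : CS * n ^ 3 * (R ^ 2 * (CB ^ 2 * 4 ^ j * n ^ (-(2 * η * j)))) ≤ c₂ * Z := by
    have h1 : n ^ (3 : ℝ) * n ^ (-(2 * η * j)) ≤ n ^ (2 : ℝ) := by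
      rw [← Real.rpow_add hn0]; exact Real.rpow_le_rpow_of_exponent_le hn1 (by linarith)
    have h2 : n ^ (3 : ℝ) * n ^ (-(2 * η * j)) * R ^ 2 ≤ n ^ (2 : ℝ) * R ^ 2 :=
      mul_le_mul_of_nonneg_right h1 (pow_nonneg hR0 2)
    have h3 : n ^ (2 : ℝ) * R ^ 2 ≤ Z := by rw [← hn2']; exact hX₁Z
    calc CS * n ^ 3 * (R ^ 2 * (CB ^ 2 * 4 ^ j * n ^ (-(2 * η * j)))) =
        c₂ * (n ^ (3 : ℝ) * n ^ (-(2 * η * j)) * R ^ 2) := by rw [hn3, hc₂]; ring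
      _ ≤ c₂ * Z := mul_le_mul_of_nonneg_left (h2.trans h3) (by positivity)
  -- (P3) the main term of the classes
  have hKT : (K : ℝ) ^ 2 * T ^ η ≤ cK ^ 2 * n ^ (18 / 5 * η) := by
    have h1 : (K : ℝ) ^ 2 ≤ (cK * T ^ η) ^ 2 := pow_le_pow_left₀ (Nat.cast_nonneg K) hKbound 2
    calc (K : ℝ) ^ 2 * T ^ η ≤ (cK * T ^ η) ^ 2 * T ^ η := mul_le_mul_of_nonneg_right h1 (by positivity)
      _ = cK ^ 2 * (T ^ η * T ^ η * T ^ η) := by ring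
      _ = cK ^ 2 * n ^ (18 / 5 * η) := by
          rw [← Real.rpow_add hT0, ← Real.rpow_add hT0, hTpow]; ring_nf
  have hP3 : CS * n ^ 3 * (cI * T ^ η * MainC) ≤ c₃ * Z := by
    -- `n³ · (3 n^{2η-1} R² + 27 n^{2η-2} T R^{7/4} + 3 n^{2η-1} T^{1/8} R^{29/16}) ≤ 27 n^{2η} Main`
    have e2 : n ^ (3 : ℝ) * n ^ (-1 : ℝ) = n ^ 2 := by rw [← Real.rpow_add hn0, hn2']; norm_num
    have e3 : n ^ (3 : ℝ) * n ^ (-2 : ℝ) = n := by rw [← Real.rpow_add hn0]; norm_num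
    have h1 : n ^ (3 : ℝ) * (3 * n ^ (2 * η) * n ^ (-1 : ℝ) * R ^ 2 + 27 * n ^ (2 * η) * n ^ (-2 : ℝ) * T * R ^ (7 / 4 : ℝ) +
        3 * n ^ (2 * η) * n ^ (-1 : ℝ) * T ^ (1 / 8 : ℝ) * R ^ (29 / 16 : ℝ)) ≤ 27 * n ^ (2 * η) * Main := by
      have e : n ^ (3 : ℝ) * (3 * n ^ (2 * η) * n ^ (-1 : ℝ) * R ^ 2 + 27 * n ^ (2 * η) * n ^ (-2 : ℝ) * T * R ^ (7 / 4 : ℝ) +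
          3 * n ^ (2 * η) * n ^ (-1 : ℝ) * T ^ (1 / 8 : ℝ) * R ^ (29 / 16 : ℝ)) =
          n ^ (2 * η) * (3 * X₁ + 27 * X₂ + 3 * X₃) := by
        calc n ^ (3 : ℝ) * (3 * n ^ (2 * η) * n ^ (-1 : ℝ) * R ^ 2 + 27 * n ^ (2 * η) * n ^ (-2 : ℝ) * T * R ^ (7 / 4 : ℝ) +
              3 * n ^ (2 * η) * n ^ (-1 : ℝ) * T ^ (1 / 8 : ℝ) * R ^ (29 / 16 : ℝ))
            = n ^ (2 * η) * (3 * ((n ^ (3 : ℝ) * n ^ (-1 : ℝ)) * R ^ 2) + 27 * ((n ^ (3 : ℝ) * n ^ (-2 : ℝ)) * T * R ^ (7 / 4 : ℝ)) +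
              3 * ((n ^ (3 : ℝ) * n ^ (-1 : ℝ)) * T ^ (1 / 8 : ℝ) * R ^ (29 / 16 : ℝ))) := by ring
          _ = n ^ (2 * η) * (3 * X₁ + 27 * X₂ + 3 * X₃) := by rw [e2, e3, hX₁, hX₂, hX₃]; ring
      rw [e, hMain]
      have : 3 * X₁ + 27 * X₂ + 3 * X₃ ≤ 27 * (X₁ + X₂ + X₃) := by linarith
      calc n ^ (2 * η) * (3 * X₁ + 27 * X₂ + 3 * X₃) ≤ n ^ (2 * η) * (27 * (X₁ + X₂ + X₃)) :=
            mul_le_mul_of_nonneg_left this (by positivity)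
        _ = _ := by ring
    -- the exponent: `(6/5)η + (18/5)η + 2η = 34η/5 ≤ δ`
    have hexp : T ^ η * ((K : ℝ) ^ 2 * T ^ η) * n ^ (2 * η) ≤ cK ^ 2 * n ^ δ := by
      calc T ^ η * ((K : ℝ) ^ 2 * T ^ η) * n ^ (2 * η) ≤ T ^ η * (cK ^ 2 * n ^ (18 / 5 * η)) * n ^ (2 * η) := by
            gcongr
        _ = cK ^ 2 * (n ^ (6 / 5 * η) * n ^ (18 / 5 * η) * n ^ (2 * η)) := by rw [hTpow]; ring
        _ = cK ^ 2 * n ^ (34 / 5 * η) := by rw [← Real.rpow_add hn0, ← Real.rpow_add hn0]; ring_nf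
        _ ≤ cK ^ 2 * n ^ δ := by
            refine mul_le_mul_of_nonneg_left (Real.rpow_le_rpow_of_exponent_le hn1 ?_) (by positivity)
            rw [hη]; linarith
    have e4 : CS * n ^ 3 * (cI * T ^ η * MainC) = CS * cI * (CA * CΦ) * (T ^ η * ((K : ℝ) ^ 2 * T ^ η)) *
        (n ^ (3 : ℝ) * (3 * n ^ (2 * η) * n ^ (-1 : ℝ) * R ^ 2 + 27 * n ^ (2 * η) * n ^ (-2 : ℝ) * T * R ^ (7 / 4 : ℝ) +
          3 * n ^ (2 * η) * n ^ (-1 : ℝ) * T ^ (1 / 8 : ℝ) * R ^ (29 / 16 : ℝ))) := by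
      rw [hMainC, hn3]; ring
    rw [e4]
    have h0 : 0 ≤ CS * cI * (CA * CΦ) * (T ^ η * ((K : ℝ) ^ 2 * T ^ η)) := by positivity
    calc CS * cI * (CA * CΦ) * (T ^ η * ((K : ℝ) ^ 2 * T ^ η)) * (n ^ (3 : ℝ) * (3 * n ^ (2 * η) * n ^ (-1 : ℝ) * R ^ 2 +
          27 * n ^ (2 * η) * n ^ (-2 : ℝ) * T * R ^ (7 / 4 : ℝ) + 3 * n ^ (2 * η) * n ^ (-1 : ℝ) * T ^ (1 / 8 : ℝ) * R ^ (29 / 16 : ℝ)))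
        ≤ CS * cI * (CA * CΦ) * (T ^ η * ((K : ℝ) ^ 2 * T ^ η)) * (27 * n ^ (2 * η) * Main) :=
          mul_le_mul_of_nonneg_left h1 h0
      _ = CS * cI * (27 * (CA * CΦ)) * (T ^ η * ((K : ℝ) ^ 2 * T ^ η) * n ^ (2 * η)) * Main := by ring
      _ ≤ CS * cI * (27 * (CA * CΦ)) * (cK ^ 2 * n ^ δ) * Main := by
          refine mul_le_mul_of_nonneg_right (mul_le_mul_of_nonneg_left hexp (by positivity)) hMain0
      _ = c₃ * Z := by rw [hc₃, hZ]; ring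
  -- (P4)+(P5) the negligible parts of the classes
  have hP45 : CS * n ^ 3 * (cI * T ^ η * NeglC) ≤ c₄ * Z := by
    have ha : n ^ (3 : ℝ) * n ^ (6 / 5 * η) * n ^ (-((1 - η) * (2 * (j : ℝ) - 4))) ≤ n ^ (2 : ℝ) := by
      rw [← Real.rpow_add hn0, ← Real.rpow_add hn0]
      refine Real.rpow_le_rpow_of_exponent_le hn1 ?_
      have : 9 / 10 * 20 ≤ (1 - η) * (2 * (j : ℝ) - 4) := by
        have h1 : (9 / 10 : ℝ) ≤ 1 - η := by linarith
        have h2 : (20 : ℝ) ≤ 2 * (j : ℝ) - 4 := by linarith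
        exact mul_le_mul h1 h2 (by norm_num) (by linarith)
      linarith
    have hb : n ^ (3 : ℝ) * n ^ (6 / 5 * η) * (n ^ (6 / 5 * (4 : ℝ)) * n ^ (-(2 * η * j))) ≤ n ^ (2 : ℝ) := by
      rw [← Real.rpow_add hn0, ← Real.rpow_add hn0, ← Real.rpow_add hn0]
      refine Real.rpow_le_rpow_of_exponent_le hn1 ?_
      linarith
    have hT4 : T ^ 4 = n ^ (6 / 5 * (4 : ℝ)) := by rw [← hTpow]; norm_num
    have h2 : n ^ (2 : ℝ) * R ^ 2 ≤ Z := by rw [← hn2']; exact hX₁Z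
    have e : CS * n ^ 3 * (cI * T ^ η * NeglC) =
        CS * cI * (CA * (324 * 2 ^ (2 * j - 4))) * ((n ^ (3 : ℝ) * n ^ (6 / 5 * η) * n ^ (-((1 - η) * (2 * (j : ℝ) - 4)))) * R ^ 2) +
        CS * cI * (CA * (6561 * 9 ^ j)) * ((n ^ (3 : ℝ) * n ^ (6 / 5 * η) * (n ^ (6 / 5 * (4 : ℝ)) * n ^ (-(2 * η * j)))) * R ^ 2) := by
      rw [hNeglC, hn3, hTpow η, hT4]; ring
    rw [e]
    have k1 : 0 ≤ CS * cI * (CA * (324 * 2 ^ (2 * j - 4))) := by positivity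
    have k2 : 0 ≤ CS * cI * (CA * (6561 * 9 ^ j)) := by positivity
    have hR2 : 0 ≤ R ^ 2 := pow_nonneg hR0 2
    have i1 : (n ^ (3 : ℝ) * n ^ (6 / 5 * η) * n ^ (-((1 - η) * (2 * (j : ℝ) - 4)))) * R ^ 2 ≤ Z :=
      (mul_le_mul_of_nonneg_right ha hR2).trans h2
    have i2 : (n ^ (3 : ℝ) * n ^ (6 / 5 * η) * (n ^ (6 / 5 * (4 : ℝ)) * n ^ (-(2 * η * j)))) * R ^ 2 ≤ Z :=
      (mul_le_mul_of_nonneg_right hb hR2).trans h2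
    calc _ ≤ CS * cI * (CA * (324 * 2 ^ (2 * j - 4))) * Z + CS * cI * (CA * (6561 * 9 ^ j)) * Z :=
          add_le_add (mul_le_mul_of_nonneg_left i1 k1) (mul_le_mul_of_nonneg_left i2 k2)
      _ = c₄ * Z := by rw [hc₄]; ring
  -- (P6) the `A`-factor terms
  have hc₅0 : 0 ≤ c₅ := by rw [hc₅]; positivity
  have hP6 : CS * n ^ 3 * (R ^ 3 * (1 + T) ^ 4 / s ^ j) ≤ c₅ * Z := by
    have hR2 : 0 ≤ R ^ 2 := pow_nonneg hR0 2
    have h1 : R ^ 3 ≤ 2 * T * R ^ 2 := by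
      have : R ^ 3 = R * R ^ 2 := by ring
      rw [this]; exact mul_le_mul_of_nonneg_right hRT2 hR2
    have h2 : (1 + T) ^ 4 ≤ 16 * T ^ 4 := by
      have : 1 + T ≤ 2 * T := by linarith
      calc (1 + T) ^ 4 ≤ (2 * T) ^ 4 := pow_le_pow_left₀ (by positivity) this 4
        _ = 16 * T ^ 4 := by ring
    have hsj : s ^ j = n ^ (6 / 5 * (ε * j)) := by
      rw [hs, ← Real.rpow_natCast (T ^ ε) j, ← Real.rpow_mul hT0.le, hTpow]
    have hT5 : T * T ^ 4 = n ^ (6 / 5 * (5 : ℝ)) := by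
      rw [← hTpow, show (5 : ℝ) = 1 + 4 by norm_num, Real.rpow_add hT0, Real.rpow_one]; norm_num
    have h3 : n ^ (3 : ℝ) * n ^ (6 / 5 * (5 : ℝ)) / n ^ (6 / 5 * (ε * j)) ≤ n ^ (2 : ℝ) := by
      rw [← Real.rpow_add hn0, ← Real.rpow_sub hn0]
      refine Real.rpow_le_rpow_of_exponent_le hn1 ?_
      linarith
    have h4 : R ^ 3 * (1 + T) ^ 4 ≤ 32 * R ^ 2 * (T * T ^ 4) := by
      calc R ^ 3 * (1 + T) ^ 4 ≤ (2 * T * R ^ 2) * (16 * T ^ 4) :=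
            mul_le_mul h1 h2 (pow_nonneg (by linarith) 4) (mul_nonneg (mul_nonneg zero_le_two hT0.le) hR2)
        _ = 32 * R ^ 2 * (T * T ^ 4) := by ring
    have h5 : 0 < n ^ (6 / 5 * (ε * j)) := by positivity
    have h6 : n ^ (2 : ℝ) * R ^ 2 ≤ Z := by rw [← hn2']; exact hX₁Z
    calc CS * n ^ 3 * (R ^ 3 * (1 + T) ^ 4 / s ^ j)
        ≤ CS * n ^ 3 * (32 * R ^ 2 * (T * T ^ 4) / s ^ j) := by gcongr
      _ = c₅ * ((n ^ (3 : ℝ) * n ^ (6 / 5 * (5 : ℝ)) / n ^ (6 / 5 * (ε * j))) * R ^ 2) := by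
          rw [hT5, hsj, hn3, hc₅]; ring
      _ ≤ c₅ * (n ^ (2 : ℝ) * R ^ 2) :=
          mul_le_mul_of_nonneg_left (mul_le_mul_of_nonneg_right h3 hR2) hc₅0
      _ ≤ c₅ * Z := mul_le_mul_of_nonneg_left h6 hc₅0
  -- conclusion
  have hPn : CS * n ^ 3 * P ≤ c₁ * Z + c₂ * Z + c₃ * Z + c₄ * Z := by
    have h := mul_le_mul_of_nonneg_left hPle (by positivity : 0 ≤ CS * n ^ 3)
    have e : CS * n ^ 3 * (R * (CB ^ 2 * n ^ (-(2 * (j : ℝ)))) + R ^ 2 * (CB ^ 2 * 4 ^ j * n ^ (-(2 * η * j))) +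
        cI * T ^ η * (MainC + NeglC)) =
        CS * n ^ 3 * (R * (CB ^ 2 * n ^ (-(2 * (j : ℝ))))) + CS * n ^ 3 * (R ^ 2 * (CB ^ 2 * 4 ^ j * n ^ (-(2 * η * j)))) +
        CS * n ^ 3 * (cI * T ^ η * MainC) + CS * n ^ 3 * (cI * T ^ η * NeglC) := by ring
    rw [e] at h
    linarith [hP1, hP2, hP3, hP45]
  have hfinal : ‖S2 w N W‖ ≤ (c₁ + c₂ + c₃ + c₄ + c₅) * Z := by
    refine hS.trans ?_
    have e : CS * n ^ 3 * (P + R ^ 3 * (1 + T) ^ 4 / s ^ j) =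
        CS * n ^ 3 * P + CS * n ^ 3 * (R ^ 3 * (1 + T) ^ 4 / s ^ j) := by ring
    rw [e]
    linarith [hPn, hP6]
  calc ‖S2 w N W‖ ≤ (c₁ + c₂ + c₃ + c₄ + c₅) * Z := hfinal
    _ = (c₁ + c₂ + c₃ + c₄ + c₅) * n ^ δ * Main := by rw [hZ]; ring

/-- **`zeroDensity_guth_maynard` from Propositions 10.1 and 11.1 of Guth–Maynard alone.** With
Proposition 6.1 proved (`S2_bound`, using the tree's Heath-Brown theorem
`HeathBrownDZS.heathBrown_differenceSet`), the named fact
`Literature.NumberTheory.LFunctions.zeroDensity_guth_maynard` (Guth–Maynard, Theorem 1.2: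
`N(σ,T) ≪ T^{15(1−σ)/(3+5σ)+ε}`, `σ ≥ 7/10`) follows from the two remaining analytic inputs of the
proof of Proposition 3.1: the refined `S₃` bound of Proposition 10.1 (`hS3`, §§7–10 of the paper)
and the energy bound of Proposition 11.1 for `T = N^{6/5}`, `σ ∈ [7/10, 4/5]` (`hE`, §11), in the
form required by `GuthMaynardAssembly.zeroDensity_guth_maynard_of_bounds`.
[cite: GuthMaynard2026, Theorem 1.2, Propositions 6.1, 10.1, 11.1, Section 12] -/
theorem zeroDensity_guth_maynard_of_S3_of_energy
    (hS3 : ∀ w : ℝ → ℝ, ContDiff ℝ ∞ w → Function.support w ⊆ Set.Icc 1 2 →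
      (∀ u : ℝ, 6 / 5 ≤ u → u ≤ 9 / 5 → w u = 1) → (∀ u, 0 ≤ w u ∧ w u ≤ 1) →
      ∀ ε : ℝ, 0 < ε → ∀ δ : ℝ, 0 < δ → ∃ C N₀ : ℝ, ∀ N : ℕ, N₀ ≤ (N : ℝ) →
      ∀ (t₀ : ℝ) (W : Finset ℝ), (∀ t ∈ W, t₀ ≤ t ∧ t ≤ t₀ + (N : ℝ) ^ (6 / 5 : ℝ)) →
      (∀ t ∈ W, ∀ t' ∈ W, t ≠ t' → ((N : ℝ) ^ (6 / 5 : ℝ)) ^ ε ≤ |t - t'|) →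
      ‖S3 w N W‖ ≤ C * (N : ℝ) ^ δ * (((N : ℝ) ^ (6 / 5 : ℝ)) ^ 2 * (W.card : ℝ) ^ (3 / 2 : ℝ) +
        (N : ℝ) ^ (6 / 5 : ℝ) * N * (W.card : ℝ) ^ (1 / 2 : ℝ) * (GuthMaynardAssembly.addEnergy W) ^ (1 / 2 : ℝ)))
    (hE : ∀ σ : ℝ, 7 / 10 ≤ σ → σ ≤ 4 / 5 → ∀ δ : ℝ, 0 < δ → ∃ C N₀ : ℝ, ∀ N : ℕ, N₀ ≤ (N : ℝ) →
      ∀ (a : ℕ → ℂ) (t₀ : ℝ) (W : Finset ℝ), (∀ n, ‖a n‖ ≤ 1) →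
      (∀ t ∈ W, t₀ ≤ t ∧ t ≤ t₀ + (N : ℝ) ^ (6 / 5 : ℝ)) →
      (∀ t ∈ W, ∀ t' ∈ W, t ≠ t' → 1 ≤ |t - t'|) →
      (∀ t ∈ W, (N : ℝ) ^ σ ≤ ‖∑ n ∈ Finset.Icc N (2 * N), a n * (n : ℂ) ^ ((t : ℂ) * I)‖) →
      GuthMaynardAssembly.addEnergy W ≤ C * (N : ℝ) ^ δ * ((W.card : ℝ) * (N : ℝ) ^ (4 - 4 * σ) +
        (W.card : ℝ) ^ (21 / 8 : ℝ) * ((N : ℝ) ^ (6 / 5 : ℝ)) ^ (1 / 4 : ℝ) * (N : ℝ) ^ (1 - 2 * σ) +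
        (W.card : ℝ) ^ 3 * (N : ℝ) ^ (1 - 2 * σ))) :
    zeroDensity_guth_maynard :=
  GuthMaynardAssembly.zeroDensity_guth_maynard_of_bounds
    (fun _ hw hsupp _ _ _ hε _ hδ ↦ S2_bound hw hsupp hε hδ) hS3 hE

end weight

end GuthMaynardS2

end Literature.NumberTheory.LFunctions

end
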